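import Literature.MathematicalPhysics.QuantumFieldTheory.Balaban1983to89.B9Cor36GCubeAtLocCfg
import Literature.MathematicalPhysics.QuantumFieldTheory.Balaban1983to89.B9Cor36GpCubeLocAtMember
import Literature.MathematicalPhysics.QuantumFieldTheory.Balaban1983to89.B9CubeLettersInvWriteDictB

/-!
# `Balaban1983to89.B9Cor36GCubeEntriesAtV` — [Balaban1985BackgroundPropagators] COROLLARY 3.6 p. 408 AT ONE COVER CUBE □ FOR THE BOND-SECTOR CUBE LETTER
# `G_□(Ṽ_□) = Δ_{a,□}(Ṽ_□)⁻¹`: THE (3.42) ENTRIES OF THEOREM 3.3 WITH THE COVARIANT BOND DERIVATIVES AT `Ṽ_□` — `|G_□J|, |∇_{Ṽ}G_□J|, |Δ_{Ṽ}G_□J| ≦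
# B[(Lⁿη)², Lⁿη, 1]e^{−δd}|J|` proved, `|G_□∇*_{Ṽ}J| ≦ B·Lⁿη·e^{−δd}|J|` modulo its flat half — as conj-`b` block majorants over the CUBE SEQUENCE's blocks,
# from G-F7 v1.1's transferred flat entries by the `(Ṽ_□ − 1)`-shift corrections of the bond derivative letters and the lattice Leibniz rule for `∇*_1`
# through the defect multiplier (sub-row G-B9-LETTERS, module M5.1b-G «Cor 3.5∕3.6 for the bond-sector cube letter G_□», FILE G-F6a; the bond twin of
# p33's site-sector FILE 7b-C `B9Cor36GpCubeEntriesAtV`)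

T. Bałaban, *Propagators for lattice gauge theories in a background field*, Commun. Math. Phys. **99** (1985) 389–434
[`Balaban1985BackgroundPropagators`, "B9"]; [4] = T. Bałaban, *Propagators and renormalization transformations for lattice gauge theories. II*,
Commun. Math. Phys. **96** (1984) 223–250 [`Balaban1984PropagatorsII`].

statement-level skeleton of published theorems with citation tags; proofs where landed; nothing here is a claim about the
Yang–Mills mass gap

THE PRINTED LOCUS (verbatim, held `paper:balaban1985-cmp99-background-propagators`, journal page = PDF page + 388; page owner r06).  Cor. 3.6 p. 408
l. 1–10: *«If a configuration U satisfies (3.35) with O(1)Mα₀ ≦ a₁, and Ω′₀ ⊂ □ for a cube □ of the class described in this condition, then Theorems 3.1-3.3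
hold for the operators G′(U), (Q′(U)G′²(U)Q′\*(U))⁻¹, G(U) constructed for the sequence {Ω′_j} … U′ = U^u = e^{iηA} … satisfies (3.37) for the
sequence {Ω′_j} with U = 1»*; Thm 3.1 (3.42) p. 397: *«|(G′(U)λ)(x)|, |(∇_U G′(U)λ)(x)|, |(G′(U)∇\*_U λ)(x)|, |(Δ_U G′(U)λ)(x)| ≦ B₀[(Lʲη)², Lʲη, Lʲη,
1]e^{−δ₀d(y,y′)}|λ|»*; Thm 3.3 p. 399: *«the operator G(U) (a = 1) satisfies the inequalities (3.42)–(3.47), with G′(U) replaced by G(U) and λ replaced by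
a function J defined at bonds»*; Thm 3.4 p. 400 («The extended operators satisfy all the inequalities of Theorems 3.1-3.3 correspondingly»); p. 403 l. 1–9
and (3.70) p. 404 (`∇_{U′U} = ∇_U + (U′ − 1)`-terms); (3.3) p. 390, (3.8) p. 392, (3.23) p. 394 (`∇_{U,μ}`, `∇*_{U,μ}`, `Σ_μ∇*_{U,μ}∇_{U,μ}` on bond
functions); (3.37) p. 396; (3.100) p. 413 (the lattice Leibniz rule); p. 398 remark («the choice of derivatives ∇_U, ∇\*_U is conventional»); p. 409
l. 1–5 (the cube operators `G_□(U)`).  [4] (2.51)–(2.55) p. 232, Lemma 2.1 (2.60)–(2.63) p. 234, Prop. 2.6 (2.136) p. 247.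

WHY THIS FILE (cell `lit-balaban`; module M5.1b-G, p38 g44; successor plan of `lit-balaban-p38/RECORD-M51bG-g43.md` §Remaining item 1).  The member-side
(3.42) block `hE` of the bond writer (`B9CubeLettersInvWriteDictB.eBlock_kernelFamilyBInv_of_hasMajorant`, M5.7's consumer
`B9Thm310DeltaAIsUnitOfExpansion.eBlock_kernelFamilyBInv_GAY_of_localInverseCubes''`) reads the bond derivatives AT THE CONFIGURATION: def-Y's
`cdB (cfg U₁) ν`, `cdsB (cfg U₁) ν`, `lapB (cfg U₁)`.  G-F7 v1.1 (`B9Cor36GCubeAtLocCfg.cor36_G_cube_at_locCfg'`) delivers, uniformly in the member and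
the cube, `IsUnit Δ_{a,□}(Ṽ_□)` and the three transferred LEFT entries of `conj b(G_□(Ṽ_□))` with the FLAT letters `DK ν = conj b(∇_{1,ν})`,
`LapK = conj b(Δ_1)`.  THIS FILE closes the gap on the cube side for the left entries: (a) `∇_{Ṽ,μ} − ∇_{1,μ} = F_μσ_μ` with `F_μ = c_f(R(Ṽ_μ) − 1)` a
SITE-LOCAL multiplier of size `2α_W(s)·(Lⁿη)⁻¹` at every block's length (bridge II's uniform window `‖Ṽ − 1‖ ≦ α_W(s)η∕len(a)`, the (3.37) reading),
so `∇_{Ṽ,μ}·G_□(Ṽ_□)` inherits the (3.42)₂ shape from the transferred flat entry by [4]'s shift calculus (p33's `hasMajorant_shift_mul_weighted`); (b)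
`Δ_Ṽ − Δ_1 = Σ_μ[−F′_μ∇_{1,μ} + c_f(F′_μ − F_μ)σ_μ + B_μσ_{−μ}∇_{1,μ} + B_μF′_μ]` (`F′_μ`, `B_μ` the translated ∕ inverse multipliers; the middle
term is the DIFFERENCE QUOTIENT of the multiplier, of size `2α_W(s)(Lⁿη)⁻²` by the variation window `‖Ṽ(y) − Ṽ(y − e_μ)‖ ≦ α_W(s)(η∕len(a))²` =
the `|∇^ηA′|` half of (3.37)) gives (3.42)₄ at `Ṽ_□` with NO bare derivative left over; (c) the right entry `G_□(Ṽ_□)·∇*_{Ṽ,ν} = G_□(Ṽ_□)·∇*_{1,ν} +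
(G_□(Ṽ_□)B_ν)σ_{−ν}` is reduced to its FLAT half `G_□(Ṽ_□)·∇*_{1,ν}` (displayed: cell GAPS G-B9-02 — p33 g101's programme RIGHT-ENTRY-L0 supplies the flat
right entry of `G_□(1)` ([4] (2.136)₃ by the transposed walk), r06's `B9Ineq386RightEntry.gExt_rightEntry_of_386L` its transfer to `Ṽ_□`).

WHAT THIS FILE PROVES (THEOREMS + `def`s with bodies `shiftOpB`, `shiftOpB'` (the one-step translations of bond functions), `mulOpB` (the site-local
multiplier `c_f(R(W) − 1)`) and the `abbrev`s `mulDefBF`, `mulDefBF'`, `mulDefBB`; 0 `def … : Prop`, 0 sorry).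
* §1 LETTERS AND IDENTITIES (any background `V`): `cdB_one'`, `cdsB_one'`, ★ `cdBₗ_eq_add` (`∇_{V,μ} = ∇_{1,μ} + F_μσ_μ`), ★ `cdsBₗ_eq_add` (`∇*_{V,μ} =
  ∇*_{1,μ} + B_μσ_{−μ}`), `cdsBₗ_one_mul_shiftOpB` (`∇*_{1,μ}σ_μ = −∇_{1,μ}`), `shiftOpB'_mul_mulDefBF_mul_shiftOpB` (`σ_{−μ}F_μσ_μ = F′_μ`), ★
  `cdsBₗ_one_mul_mulDefBF` (LEIBNIZ: `∇*_{1,μ}F_μ = F′_μ∇*_{1,μ} + c_f(F′_μ − F_μ)`), `conj_congr_of_liftY`, `conj_cdBₗ_one` (`conj b(∇_{1,μ}) = DK`, def-Y's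
  `cdB_one_eq_nablaY`), `conj_lapBₗ_one` (`conj b(Δ_1) = LapK`, def-Y's `lapB_one_liftY`), `lapBₗ_eq_sum`, ★★ `cdsBₗ_mul_cdBₗ_eq` (the per-direction
  expansion of `∇*_{V,μ}∇_{V,μ} − ∇*_{1,μ}∇_{1,μ}`).
* §2 SIZES: `blkBK_eq`, `shiftOpB_liftY`, `shiftOpB'_liftY`, `hasMajorant_shB`, `hasMajorant_shBi`, ★ `hasMajorant_conj_shiftOpB`, ★ `hasMajorant_conj_shiftOpB'`
  (`σ_{±μ} ≺ e^{θ}e^{−θd}` over `(toB6 (geoCK i □), blkBK)`), `abs_cf_mul_eta_mul`, ★ `norm_mulOpB_apply_le`, ★ `norm_mulOpB_inv_apply_le` (`2ω·t·‖X‖` under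
  a window `‖W − 1‖ ≦ ωηt`, bi-contractive `W`), ★ `norm_mulDiff_apply_le` (`2ω·t²·‖X‖` under `‖W(x−e_μ) − W(x)‖ ≦ ω(ηt)²`).
* §3 `conj_sum'`, `conj_smul'`, ★★★ `cor36_G_cube_entries_at_locCfg'` (v1.1: ALSO the LEFT BACKWARD entry `∀ν conj b(cdsBₗ Ṽ_□ ν)·GVK ≺ B_f·Lⁿη·e^{−δd}`, by
  `cdsBₗ_one_eq_neg` `∇*_{1,ν} = −σ_{−ν}∇_{1,ν}`; needed by the member Laplacian's Leibniz rule through `h_□`, G-F6b) and its projection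
  `cor36_G_cube_entries_at_locCfg` (v1.0's statement verbatim): under G-F7's hypothesis list VERBATIM (the (3.35) cube datum `(A; Q, C, ξ, Λ)` of
  Hermitian type, member thresholds, `sRead C Λ ≦ a₁`): `IsUnit Δ_{a,□}(Ṽ_□)` ∧ `GVK(Ṽ_□) ≺ B_f(Lⁿη)²e^{−δd}` ∧ `∀ν conj b(cdBₗ Ṽ_□ ν)·GVK ≺ B_f·Lⁿη·e^{−δd}`
  ∧ `conj b(lapBₗ Ṽ_□)·GVK ≺ B_f·1·e^{−δd}` ∧ (∀ ν B₂ ρ′ ≦ δ) `GVK·conj b(cdsBₗ 1 ν) ≺ B₂·Lⁿη·e^{−ρ′d} ⟹ GVK·conj b(cdsBₗ Ṽ_□ ν) ≺ (B₂+B_f)·Lⁿη·e^{−ρ′d}`;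
  `δ = (1 − 9∕5000)³ρ` with G-F7's `ρ`, `B_f` an explicit polynomial in `A_Gθ`, `M₂Σ‖b_j‖`, `L⁴`, `c₁²`, `e^{ρ}`, `d + 1`; `a₁` = G-F7's capped at `1∕120`
  (so `α_W(s) ≦ ½`).

PROOF.  Ours, following p. 403's treatment of `∇_{U′U} − ∇_U` on the bond sector and the lattice product rule (3.100); [4]'s majorant calculus BY NAME (p33's
FILE 5b `hasMajorant_shift_mul_weighted`, FILE 7b-B `hasMajorant_mul_of_rowLocal(_right)` ∕ `rowLocal_conj_of_local`, FILE 7b-C `hasMajorant_weighted_mul_shift`,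
FILE 7b-D2 `hasMajorant_finset_sum`); the inputs from G-F7 v1.1, bridge II (`norm_locCfgY_sub_one_le`, `norm_locCfgY_sub_unshift_le`, `unitaryLike_locCfgY`,
`len_bounds`), G-F5a III (`norm_R_sub_R_le`, `norm_Rinv_sub_self_le`), [B11] `norm_R_sub_self_le`, p33's `exists_h261_geoCK` ∕ `hST_geoCK`.

HONEST SCOPE ∕ NOT CLAIMED.  `[NormOneClass 𝔸]`; the (3.35) cube datum, Hermitian type `hAu`, the member thresholds and `sRead C Λ ≦ a₁` are displayed
hypotheses (as G-F7); `parS = parSymY i`, `parB = parBY i` (G-F7's road; the averaging piece of `V(A)` is typed at `parBY`); the RIGHT entry (3.42)₃ is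
proved MODULO its flat half at `Ṽ_□` (`GVK(Ṽ_□)·conj b(cdsBₗ 1 ν)`, cell GAPS G-B9-02; print p. 398: «we may always replace ∇_U by ∇\*_U»; not derived
here); constants unoptimised (`α_W ≦ 1` absorbed); the member-side block `hE` of the cut∕transported letter is G-F6b; Hölder ∕ L² ∕ (3.43)–(3.47) entries
are NOT treated; nothing on `d = 4`, the continuum, reflection positivity; NOT a node discharge; no summit ∕ sub-problem statement is proved; YM mass gap
NOT proved by any of this (Track A conditional rung).  No `sorry`, no `axiom`, no `… : Prop` fact, no `instance`, no `notation`.  v1.0 NEW file (p660501);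
v1.1 (same seat, same day) ADDS `cdsBₗ_one_eq_neg` and the primed six-conjunct theorem, keeps every v1.0 declaration with its statement verbatim (the
v1.0 main theorem becomes the projection), and re-keys four page numerals «(3.23) p.394» (page owner r06 g68, 2026-08-28T19:26:51Z).  Cell `lit-balaban`, seat `lit-balaban-p38` gen 44, 2026-08-28; `--supports stmt-QuantumFields-19200` as helper.
Net new unproved facts: 0.

RELATED IN THE TREE, NOT DUPLICATED (searched 2026-08-28: `rg 'shiftOpB|mulOpB|GCubeEntriesAtV|cdBₗ_eq_add'` over `Literature/` = ∅): p33's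
`B9Cor36GpCubeEntriesAtV` (the SITE-sector twin: `shiftOpY`, `mulDefF∕B`, `diffLetter_inl_eq_add`; there the Laplacian entry comes from the equation
`Δ′_{a,□}G′_□ = 1`, here — `Δ_a = Δ + DRD* + Q*aQ` having no such shortcut for `Σ∇*∇` — from the perturbative expansion (b)); n06-c's
`B9SectBGpTransferOutY.norm_R_sub_self_le` ∕ `cdS_mulY_apply` (the member's `∇_{U′U}` split, other carrier); def-Y `Node00.OpsYOfLetters` (`cdB`, `cdsB`,
`lapB`), `B9CoReadingCoords` (`cdBₗ`, `cdsBₗ`, `lapBₗ`), `B9Cor35ComparisonsGAAtLetters.lapB_one_liftY`, `B9Eq371HessianSplitY.cdB_one_eq_nablaY` (USED BY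
NAME); the V1 lineage's `B6GradLegKLevelV1.shB` ∕ `B6LapLegKLevelV1.shBi` (the real bond shifts; USED); G-F4 `B9Cor35GCubeInputsAtOne` (the letters `GK`,
`DK`, `LapK`, `GVK`, `blkBK`); G-F7 v1.1.
-/

noncomputable section

namespace Literature.MathematicalPhysics.QuantumFieldTheory.Balaban1983to89.B9Cor36GCubeEntriesAtV

open Complex
open B4PartitionUnity22 (thetaProf D1)
open B6RandomWalk (HasMajorant hasMajorant_mono hasMajorant_add Ineq261 Triangle254 c1_nonneg)
open B9Thm34Ext (toB6)
open B9Ineq347 (ScaleTransfer)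
open B9Eq39Adjoint (R R_add R_sub R_smul R_one covD covDstar)
open B9Eq352DivFormLetters (conj conj_apply conj_sub conj_neg coordEquiv)
open B6KLevelCensusIndexV1 (KIdx kGeo)
open B6Cover236MultiLevelBlocks (cubes)
open B6GlobalChartV1 (PV boxEquiv)
open B6GlobalChartV1L0 (blkV1)
open B6GradLegKLevelV1 (shB shB_apply)
open B6LapLegKLevelV1 (shBi shBi_apply)
open B9BackgroundsKLevelV1 (shiftsV1)
open B9Eq360DeltaPrimeAY (AfldY)
open B9Eq360DeltaPrimeACubeY (blkCubeY)
open B9CubeLettersOpsL0 (cubeFamY)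
open B9CubeLettersBondOpsL0 (BlkCubeY deltaACubeY)
open B9CubeGeometryInputs (geoCK geoCK_len geoCK_eta geoCK_eta_pos geoCK_len_pos geoCK_dist_axioms RM1 N1 exists_h261_geoCK hST_geoCK geoCK_site_nonempty)
open B9Cor36CubeCutoffs (SC NearC locCfgY)
open B9CoReadingCoords (cdBₗ cdsBₗ lapBₗ cdBₗ_apply cdsBₗ_apply lapBₗ_apply)
open B9Cor35GpCubeInputsAtOne (coordEquiv_symm_eq_sum_liftY hasMajorant_conj_of_liftY hasMajorant_shift_mul_weighted hasMajorant_neg hasMajorant_smul)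
open B9Cor35GCubeInputsAtOne (blkBK GK DK LapK GVK VK kGeo_eta)
open B9Cor35CinvAtCubeLetters (kernel_rate_mono)
open B9Eq371HessianSplitY (nablaY cdB_one_eq_nablaY)
open B9Ineq373HessianPieceBoundsY (dSite dSite_shift_le dSite_self norm_R_sub_R_le norm_Rinv_sub_self_le)
open B9Cor36GCubeWindows (sRead sRead_nonneg alphaW alphaW_nonneg mul_exp_le_alphaW unitaryLike_locCfgY norm_locCfgY_sub_one_le norm_locCfgY_sub_unshift_le len_bounds)
open B9Cor36GCubeAtLocCfg (alphaW_le_sixty_mul cor36_G_cube_at_locCfg')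
open B9Cor36SiteSandwichTransfer (hasMajorant_mul_of_rowLocal hasMajorant_mul_of_rowLocal_right rowLocal_conj_of_local)
open B9Cor36GpCubeEntriesAtV (hasMajorant_weighted_mul_shift hasMajorant_one_decay conj_add')
open B9Cor36GpCubeLocAtMember (hasMajorant_congr_op hasMajorant_finset_sum kernel_le)
open B9Cor35GpAtCubeLetters (hasMajorant_weaken)
open Node00 (SiteY CfgY FBondY toKT parSymY parBY liftY liftY_apply liftEndY liftEndY_liftY cdB cdsB lapB cdB_one cdsB_one)
open Node00.OpsYNablaBridge (chartY shift_unshift unshift_shift)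

variable {d ℓ : ℕ} {hd : 1 ≤ d + 1} {hL : Odd (ℓ + 1) ∧ 1 < ℓ + 1} {b₀ b₁ : ℝ}
variable {𝔸 : Type} [NormedRing 𝔸] [NormedAlgebra ℂ 𝔸] [CompleteSpace 𝔸]
variable {ι : Type} [Fintype ι]

/-! ## §1  The bond-sector letters: one-step translations, the `(Ṽ − 1)`-defect multipliers, and the identities `∇_{Ṽ,μ} = ∇_μ + F_μσ_μ`, `∇*_{Ṽ,μ} = ∇*_μ + B_μσ_{−μ}`, Leibniz -/

section Letters

variable (i : KIdx d ℓ hd hL b₀ b₁)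

/-- **the forward translation `(σ_μX)(x, κ) = X(x + e_μ, κ)` of `𝔸`-valued bond functions** (same direction slot; the shift inside (3.3)'s `∇_{U,μ}` on the bond sector).
[cite: Balaban1985BackgroundPropagators, (3.3) p.390, dictionary] -/
def shiftOpB (μ : Fin (d + 1)) : (FBondY i → 𝔸) →ₗ[ℂ] (FBondY i → 𝔸) where
  toFun X := fun f => X ⟨f.src.shift μ, f.dir⟩
  map_add' _ _ := rfl
  map_smul' _ _ := rfl

/-- **the backward translation `(σ_{−μ}X)(x, κ) = X(x − e_μ, κ)`** (the shift inside (3.8)'s `∇*_{U,μ}` on the bond sector). [cite: Balaban1985BackgroundPropagators, (3.8) p.392, dictionary] -/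
def shiftOpB' (μ : Fin (d + 1)) : (FBondY i → 𝔸) →ₗ[ℂ] (FBondY i → 𝔸) where
  toFun X := fun f => X ⟨f.src.unshift μ, f.dir⟩
  map_add' _ _ := rfl
  map_smul' _ _ := rfl

/-- **the bond-sector defect multiplier `X ↦ (⟨x,κ⟩ ↦ c_f·(R(W(x))X(x,κ) − X(x,κ)))`** for a field of units `W` on the torus sites (site-local, physical units `c_f`): with
`W = Ṽ_μ` it is `∇_{Ṽ,μ} − ∇_{1,μ}` before the translation, with `W = Ṽ_μ(· − e_μ)⁻¹` it is `∇*_{Ṽ,μ} − ∇*_{1,μ}` before the translation (p. 403's treatment of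
`∇_{U′U} − ∇_U`). [cite: Balaban1985BackgroundPropagators, p.403 l.1–9, (3.70) p.404, (3.3) p.390, (3.8) p.392] -/
def mulOpB (W : Site (PV d ℓ i.m i.K hd hL) 0 → 𝔸ˣ) : Module.End ℝ (FBondY i → 𝔸) where
  toFun X := fun f => ((i.cf : ℝ) : ℂ) • (R (W f.src) (X f) - X f)
  map_add' X Y := by
    funext f
    simp only [Pi.add_apply, R_add, add_sub_add_comm, ← smul_add]
  map_smul' r X := by
    funext f
    simp only [Pi.smul_apply, RingHom.id_apply]
    rw [← Complex.coe_smul, ← Complex.coe_smul, R_smul, ← smul_sub, smul_comm]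

/-- the forward defect multiplier `F_μ = c_f(R(V_μ(x)) − 1)`. [cite: Balaban1985BackgroundPropagators, p.403 l.1–9, (3.70) p.404] -/
abbrev mulDefBF (V : CfgY 𝔸 i) (μ : Fin (d + 1)) : Module.End ℝ (FBondY i → 𝔸) := mulOpB i (V μ)

/-- the SHIFTED forward defect multiplier `F′_μ = c_f(R(V_μ(x − e_μ)) − 1)` (appears when `∇*_{1,μ}` is moved through `F_μ`). [cite: Balaban1985BackgroundPropagators, p.403 l.1–9, (3.100) p.413] -/
abbrev mulDefBF' (V : CfgY 𝔸 i) (μ : Fin (d + 1)) : Module.End ℝ (FBondY i → 𝔸) := mulOpB i (fun x => V μ (x.unshift μ))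

/-- the backward defect multiplier `B_μ = c_f(R(V_μ(x − e_μ))⁻¹ − 1)`. [cite: Balaban1985BackgroundPropagators, p.403 l.1–9, (3.8) p.392] -/
abbrev mulDefBB (V : CfgY 𝔸 i) (μ : Fin (d + 1)) : Module.End ℝ (FBondY i → 𝔸) := mulOpB i (fun x => (V μ (x.unshift μ))⁻¹)

omit [CompleteSpace 𝔸] in
/-- `mulOpB` applied. [cite: Balaban1985BackgroundPropagators, p.403, bookkeeping] -/
@[simp] theorem mulOpB_apply (W : Site (PV d ℓ i.m i.K hd hL) 0 → 𝔸ˣ) (X : FBondY i → 𝔸) (f : FBondY i) :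
    mulOpB i W X f = ((i.cf : ℝ) : ℂ) • (R (W f.src) (X f) - X f) := rfl

omit [CompleteSpace 𝔸] in
/-- `σ_μ` applied. [cite: Balaban1985BackgroundPropagators, (3.3) p.390, bookkeeping] -/
@[simp] theorem shiftOpB_apply (μ : Fin (d + 1)) (X : FBondY i → 𝔸) (f : FBondY i) :
    (shiftOpB i μ).restrictScalars ℝ X f = X ⟨f.src.shift μ, f.dir⟩ := rfl

omit [CompleteSpace 𝔸] in
/-- `σ_{−μ}` applied. [cite: Balaban1985BackgroundPropagators, (3.8) p.392, bookkeeping] -/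
@[simp] theorem shiftOpB'_apply (μ : Fin (d + 1)) (X : FBondY i → 𝔸) (f : FBondY i) :
    (shiftOpB' i μ).restrictScalars ℝ X f = X ⟨f.src.unshift μ, f.dir⟩ := rfl

/-- the flat forward bond derivative in the `shift` normal form. [cite: Balaban1985BackgroundPropagators, (3.3) p.390, p.395, bookkeeping] -/
theorem cdB_one' (μ : Fin (d + 1)) (A : FBondY i → 𝔸) (f : FBondY i) :
    cdB i (fun _ _ => 1) μ A f = ((i.cf : ℝ) : ℂ) • (A ⟨f.src.shift μ, f.dir⟩ - A f) := cdB_one i μ A f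

/-- the flat backward bond derivative in the `unshift` normal form. [cite: Balaban1985BackgroundPropagators, (3.8) p.392, p.395, bookkeeping] -/
theorem cdsB_one' (μ : Fin (d + 1)) (A : FBondY i → 𝔸) (f : FBondY i) :
    cdsB i (fun _ _ => 1) μ A f = ((i.cf : ℝ) : ℂ) • (A ⟨f.src.unshift μ, f.dir⟩ - A f) := cdsB_one i μ A f

/-- ★ **`∇_{V,μ} = ∇_{1,μ} + F_μσ_μ` on the bond sector** (`c_f(R(V_μ(x))X(x+e_μ) − X(x)) = c_f(X(x+e_μ) − X(x)) + c_f(R(V_μ(x)) − 1)X(x+e_μ)`).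
[cite: Balaban1985BackgroundPropagators, p.403 l.1–9, (3.70) p.404, (3.3) p.390] -/
theorem cdBₗ_eq_add (V : CfgY 𝔸 i) (μ : Fin (d + 1)) :
    cdBₗ i V μ = cdBₗ i (fun _ _ => 1) μ + mulDefBF i V μ * (shiftOpB i μ).restrictScalars ℝ := by
  refine LinearMap.ext fun X => funext fun f => ?_
  rw [LinearMap.add_apply, Module.End.mul_apply, Pi.add_apply, cdBₗ_apply, cdBₗ_apply]
  show ((i.cf : ℝ) : ℂ) • covD _ V μ _ f.src = ((i.cf : ℝ) : ℂ) • covD _ _ μ _ f.src +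
    ((i.cf : ℝ) : ℂ) • (R (V μ f.src) (X ⟨f.src.shift μ, f.dir⟩) - X ⟨f.src.shift μ, f.dir⟩)
  rw [covD, covD, R_one, ← smul_add]
  congr 1
  show R (V μ f.src) (X ⟨f.src.shift μ, f.dir⟩) - X f = X ⟨f.src.shift μ, f.dir⟩ - X f + _
  abel

/-- ★ **`∇*_{V,μ} = ∇*_{1,μ} + B_μσ_{−μ}` on the bond sector**. [cite: Balaban1985BackgroundPropagators, p.403 l.1–9, (3.8) p.392] -/
theorem cdsBₗ_eq_add (V : CfgY 𝔸 i) (μ : Fin (d + 1)) :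
    cdsBₗ i V μ = cdsBₗ i (fun _ _ => 1) μ + mulDefBB i V μ * (shiftOpB' i μ).restrictScalars ℝ := by
  refine LinearMap.ext fun X => funext fun f => ?_
  rw [LinearMap.add_apply, Module.End.mul_apply, Pi.add_apply, cdsBₗ_apply, cdsBₗ_apply]
  show ((i.cf : ℝ) : ℂ) • covDstar _ V μ _ f.src = ((i.cf : ℝ) : ℂ) • covDstar _ _ μ _ f.src +
    ((i.cf : ℝ) : ℂ) • (R (V μ (f.src.unshift μ))⁻¹ (X ⟨f.src.unshift μ, f.dir⟩) - X ⟨f.src.unshift μ, f.dir⟩)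
  rw [covDstar, covDstar, inv_one, R_one, ← smul_add]
  congr 1
  show R (V μ (f.src.unshift μ))⁻¹ (X ⟨f.src.unshift μ, f.dir⟩) - X f = X ⟨f.src.unshift μ, f.dir⟩ - X f + _
  abel

/-- `∇*_{1,μ}σ_μ = −∇_{1,μ}` (`c_f(X(x − e_μ + e_μ) − X(x + e_μ)) = −c_f(X(x + e_μ) − X(x))`). [cite: Balaban1985BackgroundPropagators, (3.3), (3.8) pp.390–392, bookkeeping] -/
theorem cdsBₗ_one_mul_shiftOpB (μ : Fin (d + 1)) :
    cdsBₗ i (fun _ _ => (1 : 𝔸ˣ)) μ * (shiftOpB i μ).restrictScalars ℝ = -cdBₗ i (fun _ _ => 1) μ := by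
  refine LinearMap.ext fun X => funext fun f => ?_
  rw [Module.End.mul_apply, LinearMap.neg_apply, Pi.neg_apply, cdsBₗ_apply, cdBₗ_apply, cdsB_one', cdB_one', ← smul_neg, neg_sub, shiftOpB_apply, shiftOpB_apply]
  show ((i.cf : ℝ) : ℂ) • (X ⟨(f.src.unshift μ).shift μ, f.dir⟩ - X ⟨f.src.shift μ, f.dir⟩) = ((i.cf : ℝ) : ℂ) • (X f - X ⟨f.src.shift μ, f.dir⟩)
  rw [shift_unshift]

/-- `∇*_{1,μ} = −σ_{−μ}∇_{1,μ}` (`c_f(X(x − e_μ) − X(x)) = −c_f(X(x − e_μ + e_μ) − X(x − e_μ))`: the flat backward derivative is minus the translated forward one).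
[cite: Balaban1985BackgroundPropagators, (3.3), (3.8) pp.390–392, bookkeeping] -/
theorem cdsBₗ_one_eq_neg (μ : Fin (d + 1)) :
    cdsBₗ i (fun _ _ => (1 : 𝔸ˣ)) μ = -((shiftOpB' i μ).restrictScalars ℝ * cdBₗ i (fun _ _ => 1) μ) := by
  refine LinearMap.ext fun X => funext fun f => ?_
  rw [LinearMap.neg_apply, Pi.neg_apply, Module.End.mul_apply, shiftOpB'_apply, cdsBₗ_apply, cdBₗ_apply, cdsB_one', cdB_one', ← smul_neg, neg_sub]
  show ((i.cf : ℝ) : ℂ) • (X ⟨f.src.unshift μ, f.dir⟩ - X f) = ((i.cf : ℝ) : ℂ) • (X ⟨f.src.unshift μ, f.dir⟩ - X ⟨(f.src.unshift μ).shift μ, f.dir⟩)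
  rw [shift_unshift]

/-- `σ_{−μ}F_μσ_μ = F′_μ` (the translated multiplier). [cite: Balaban1985BackgroundPropagators, p.403 l.1–9, bookkeeping] -/
theorem shiftOpB'_mul_mulDefBF_mul_shiftOpB (V : CfgY 𝔸 i) (μ : Fin (d + 1)) :
    (shiftOpB' i μ).restrictScalars ℝ * mulDefBF i V μ * (shiftOpB i μ).restrictScalars ℝ = mulDefBF' i V μ := by
  refine LinearMap.ext fun X => funext fun f => ?_
  rw [Module.End.mul_apply, Module.End.mul_apply, shiftOpB'_apply, mulOpB_apply, mulOpB_apply, shiftOpB_apply]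
  show ((i.cf : ℝ) : ℂ) • (R (V μ (f.src.unshift μ)) (X ⟨(f.src.unshift μ).shift μ, f.dir⟩) - X ⟨(f.src.unshift μ).shift μ, f.dir⟩) = _
  rw [shift_unshift]

/-- ★ **THE LATTICE LEIBNIZ RULE FOR `∇*_{1,μ}` THROUGH THE DEFECT MULTIPLIER**: `∇*_{1,μ}∘F_μ = F′_μ∘∇*_{1,μ} + c_f·(F′_μ − F_μ)` — the last operator is the site-local
multiplication by `c_f²(R(V_μ(x − e_μ)) − R(V_μ(x)))`, the DIFFERENCE QUOTIENT of the multiplier (`a(x−e)X(x−e) − a(x)X(x) = a(x−e)[X(x−e) − X(x)] + [a(x−e) − a(x)]X(x)`).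
[cite: Balaban1985BackgroundPropagators, (3.100) p.413 (lattice product rule), p.403 l.1–9] -/
theorem cdsBₗ_one_mul_mulDefBF (V : CfgY 𝔸 i) (μ : Fin (d + 1)) :
    cdsBₗ i (fun _ _ => (1 : 𝔸ˣ)) μ * mulDefBF i V μ =
      mulDefBF' i V μ * cdsBₗ i (fun _ _ => 1) μ + ((i.cf : ℝ) • (mulDefBF' i V μ - mulDefBF i V μ)) := by
  refine LinearMap.ext fun X => funext fun f => ?_
  simp only [Module.End.mul_apply, LinearMap.add_apply, Pi.add_apply, LinearMap.smul_apply, Pi.smul_apply, LinearMap.sub_apply, Pi.sub_apply,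
    cdsBₗ_apply, cdsB_one', mulOpB_apply, R_smul, R_sub, ← Complex.coe_smul (i.cf), smul_sub, smul_smul]
  abel

omit [CompleteSpace 𝔸] in
/-- two ℝ-linear operators on `𝔸`-valued functions agreeing on the product vectors `f ⊗ E` have the same realification (`coord⁻¹μ = Σ_i μ(·,i) ⊗ b_i`).
[cite: Balaban1984PropagatorsII, (2.51) p.232, bookkeeping] -/
theorem conj_congr_of_liftY (b : Module.Basis ι ℝ 𝔸) {S : Type} (T T' : Module.End ℝ (S → 𝔸))
    (h : ∀ (f : S → ℝ) (E : 𝔸), T (liftY f E) = T' (liftY f E)) : conj b T = conj b T' := by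
  refine LinearMap.ext fun w => funext fun p => ?_
  rw [conj_apply, conj_apply, coordEquiv_symm_eq_sum_liftY, map_sum, map_sum]
  simp only [h]

variable (b : Module.Basis ι ℝ 𝔸)

/-- `conj b(∇_{1,μ}) = DK` (def-Y's `cdB_one_eq_nablaY`: the flat bond derivative IS the lift of the V1 lineage's `DV μ c_f`, G-F4's letter).
[cite: Balaban1985BackgroundPropagators, (3.3) p.390, p.395 («coincides … if U = 1»), bookkeeping] -/
theorem conj_cdBₗ_one (μ : Fin (d + 1)) : conj b (cdBₗ i (fun _ _ => (1 : 𝔸ˣ)) μ) = DK b i μ := by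
  rw [DK]
  congr 1
  refine LinearMap.ext fun X => ?_
  rw [cdBₗ_apply, cdB_one_eq_nablaY]
  rfl

/-- `conj b(Δ_1) = LapK` (def-Y's `lapB_one_liftY`: on product vectors the flat bond Laplacian is the lift of the V1 lineage's `LapV c_f`, G-F4's letter).
[cite: Balaban1985BackgroundPropagators, (3.23) p.394; (3.26) + p.395 l.8 («coincides … if U = 1»), bookkeeping] -/
theorem conj_lapBₗ_one : conj b (lapBₗ i (fun _ _ => (1 : 𝔸ˣ))) = LapK b i := by
  rw [LapK]
  refine conj_congr_of_liftY b _ _ fun f E => ?_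
  rw [lapBₗ_apply, B9Cor35ComparisonsGAAtLetters.lapB_one_liftY, LinearMap.restrictScalars_apply, liftEndY_liftY]

/-- `Δ_V = Σ_μ ∇*_{V,μ}∇_{V,μ}` in `End`. [cite: Balaban1985BackgroundPropagators, (3.23) p.394, bookkeeping] -/
theorem lapBₗ_eq_sum (V : CfgY 𝔸 i) : lapBₗ i V = ∑ μ, cdsBₗ i V μ * cdBₗ i V μ := rfl

/-- ★ **THE COVARIANT BOND LAPLACIAN AT `V` MINUS THE FLAT ONE, DIRECTION BY DIRECTION**:
`∇*_{V,μ}∇_{V,μ} = ∇*_{1,μ}∇_{1,μ} − F′_μ∇_{1,μ} + c_f(F′_μ − F_μ)σ_μ + B_μσ_{−μ}∇_{1,μ} + B_μF′_μ`. [cite: Balaban1985BackgroundPropagators, p.403 l.1–9, (3.70) p.404, (3.100) p.413, (3.23) p.394] -/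
theorem cdsBₗ_mul_cdBₗ_eq (V : CfgY 𝔸 i) (μ : Fin (d + 1)) :
    cdsBₗ i V μ * cdBₗ i V μ =
      cdsBₗ i (fun _ _ => 1) μ * cdBₗ i (fun _ _ => 1) μ +
        (-(mulDefBF' i V μ * cdBₗ i (fun _ _ => 1) μ) + ((i.cf : ℝ) • (mulDefBF' i V μ - mulDefBF i V μ)) * (shiftOpB i μ).restrictScalars ℝ +
          mulDefBB i V μ * (shiftOpB' i μ).restrictScalars ℝ * cdBₗ i (fun _ _ => 1) μ + mulDefBB i V μ * mulDefBF' i V μ) := by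
  have h1 : cdsBₗ i (fun _ _ => (1 : 𝔸ˣ)) μ * (mulDefBF i V μ * (shiftOpB i μ).restrictScalars ℝ) =
      -(mulDefBF' i V μ * cdBₗ i (fun _ _ => 1) μ) + ((i.cf : ℝ) • (mulDefBF' i V μ - mulDefBF i V μ)) * (shiftOpB i μ).restrictScalars ℝ := by
    rw [← mul_assoc, cdsBₗ_one_mul_mulDefBF, add_mul, mul_assoc, cdsBₗ_one_mul_shiftOpB]
    congr 1
    exact LinearMap.ext fun X => funext fun f => by
      simp only [Module.End.mul_apply, LinearMap.neg_apply, Pi.neg_apply, map_neg]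
  have h2 : mulDefBB i V μ * (shiftOpB' i μ).restrictScalars ℝ * (mulDefBF i V μ * (shiftOpB i μ).restrictScalars ℝ) = mulDefBB i V μ * mulDefBF' i V μ := by
    rw [← shiftOpB'_mul_mulDefBF_mul_shiftOpB]
    simp only [mul_assoc]
  rw [cdBₗ_eq_add i V μ, cdsBₗ_eq_add i V μ, add_mul, mul_add, mul_add, h1, h2]
  abel

end Letters

/-! ## §2  Sizes at `Ṽ_□`: the multipliers are row-local of size `2α_W(Lⁿη)⁻¹`, the difference quotient of size `2α_W(Lⁿη)⁻²`; the translations' block majorants -/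

section Sizes

variable (i : KIdx d ℓ hd hL b₀ b₁) (c : ↥(cubes (toKT i).D.toDomains)) (b : Module.Basis ι ℝ 𝔸)

omit [NormedAlgebra ℂ 𝔸] [CompleteSpace 𝔸] [Fintype ι] in
/-- the block of a fine bond in the cube sequence is the block of its source site (G-F5a III's `blkV1_cubeFamY_eq`). [cite: Balaban1984PropagatorsII, p.224, dictionary] -/
theorem blkBK_eq (p : FBondY i × ι) : blkBK i c p = blkCubeY i c (chartY i p.1.src) := rfl

omit [CompleteSpace 𝔸] in
/-- `σ_μ(f ⊗ E) = (S_μ f) ⊗ E` with the V1 lineage's real bond shift. [cite: Balaban1985BackgroundPropagators, (3.3) p.390, bookkeeping] -/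
theorem shiftOpB_liftY (μ : Fin (d + 1)) (f : FBondY i → ℝ) (E : 𝔸) :
    (shiftOpB i μ).restrictScalars ℝ (liftY f E) = liftY (shB (P := PV d ℓ i.m i.K hd hL) μ f) E := rfl

omit [CompleteSpace 𝔸] in
/-- `σ_{−μ}(f ⊗ E) = (S_{−μ} f) ⊗ E`. [cite: Balaban1985BackgroundPropagators, (3.8) p.392, bookkeeping] -/
theorem shiftOpB'_liftY (μ : Fin (d + 1)) (f : FBondY i → ℝ) (E : 𝔸) :
    (shiftOpB' i μ).restrictScalars ℝ (liftY f E) = liftY (shBi (P := PV d ℓ i.m i.K hd hL) μ f) E := rfl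

/-- the real forward bond shift has the majorant `e^{θ}e^{−θd}` over the cube sequence's blocks (`θ ≥ 0`; one lattice step moves the block by `≤ 1`).
[cite: Balaban1984PropagatorsII, (2.51) p.232, (2.46) p.231] -/
theorem hasMajorant_shB (Rr : ℝ) (H : Prop) {θ : ℝ} (hθ : 0 ≤ θ) (μ : Fin (d + 1)) :
    HasMajorant (g := toB6 (geoCK i c) Rr H) (fun f : FBondY i => blkV1 i.hN (cubeFamY i c) f) (shB (P := PV d ℓ i.m i.K hd hL) μ)
      (fun a a' => Real.exp θ * Real.exp (-(θ * (geoCK i c).dist a a'))) := by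
  intro y' w B hw f
  rw [shB_apply]
  by_cases hy : blkV1 i.hN (cubeFamY i c) (⟨f.src.shift μ, f.dir⟩ : FBondY i) = y'
  · have hd1 : (geoCK i c).dist (blkV1 i.hN (cubeFamY i c) f) y' ≤ 1 := by
      rw [← hy]
      show dSite i c (blkCubeY i c (chartY i f.src)) (f.src.shift μ) ≤ 1
      have h := (dSite_shift_le i c (blkCubeY i c (chartY i f.src)) f.src μ).1
      rw [dSite_self] at h
      linarith
    have hexp : 1 ≤ Real.exp θ * Real.exp (-(θ * (geoCK i c).dist (blkV1 i.hN (cubeFamY i c) f) y')) := by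
      rw [← Real.exp_add]; exact Real.one_le_exp (by nlinarith)
    calc |w ⟨f.src.shift μ, f.dir⟩| ≤ B := hw.bound _ hy
      _ = 1 * B := (one_mul B).symm
      _ ≤ _ := mul_le_mul_of_nonneg_right hexp hw.nonneg
  · rw [hw.off _ hy, abs_zero]
    exact mul_nonneg (mul_nonneg (Real.exp_nonneg _) (Real.exp_nonneg _)) hw.nonneg

/-- the real backward bond shift has the majorant `e^{θ}e^{−θd}`. [cite: Balaban1984PropagatorsII, (2.51) p.232, (2.46) p.231] -/
theorem hasMajorant_shBi (Rr : ℝ) (H : Prop) {θ : ℝ} (hθ : 0 ≤ θ) (μ : Fin (d + 1)) :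
    HasMajorant (g := toB6 (geoCK i c) Rr H) (fun f : FBondY i => blkV1 i.hN (cubeFamY i c) f) (shBi (P := PV d ℓ i.m i.K hd hL) μ)
      (fun a a' => Real.exp θ * Real.exp (-(θ * (geoCK i c).dist a a'))) := by
  intro y' w B hw f
  rw [shBi_apply]
  by_cases hy : blkV1 i.hN (cubeFamY i c) (⟨f.src.unshift μ, f.dir⟩ : FBondY i) = y'
  · have hd1 : (geoCK i c).dist (blkV1 i.hN (cubeFamY i c) f) y' ≤ 1 := by
      rw [← hy]
      show dSite i c (blkCubeY i c (chartY i f.src)) (f.src.unshift μ) ≤ 1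
      have h := (dSite_shift_le i c (blkCubeY i c (chartY i f.src)) f.src μ).2
      rw [dSite_self] at h
      linarith
    have hexp : 1 ≤ Real.exp θ * Real.exp (-(θ * (geoCK i c).dist (blkV1 i.hN (cubeFamY i c) f) y')) := by
      rw [← Real.exp_add]; exact Real.one_le_exp (by nlinarith)
    calc |w ⟨f.src.unshift μ, f.dir⟩| ≤ B := hw.bound _ hy
      _ = 1 * B := (one_mul B).symm
      _ ≤ _ := mul_le_mul_of_nonneg_right hexp hw.nonneg
  · rw [hw.off _ hy, abs_zero]
    exact mul_nonneg (mul_nonneg (Real.exp_nonneg _) (Real.exp_nonneg _)) hw.nonneg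

omit [CompleteSpace 𝔸] in
/-- ★ `conj b(σ_μ) ≺ e^{θ}e^{−θd}` over `(toB6 (geoCK i □), blkBK)`. [cite: Balaban1984PropagatorsII, (2.51) p.232, (2.46) p.231; Balaban1985BackgroundPropagators, (3.3) p.390] -/
theorem hasMajorant_conj_shiftOpB (Rr : ℝ) (H : Prop) {θ : ℝ} (hθ : 0 ≤ θ) (μ : Fin (d + 1)) :
    HasMajorant (g := toB6 (geoCK i c) Rr H) (blkBK i c) (conj b ((shiftOpB (𝔸 := 𝔸) i μ).restrictScalars ℝ))
      (fun a a' => Real.exp θ * Real.exp (-(θ * (geoCK i c).dist a a'))) :=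
  hasMajorant_conj_of_liftY b (g := toB6 (geoCK i c) Rr H) (fun f : FBondY i => blkV1 i.hN (cubeFamY i c) f) _ _ (shiftOpB_liftY i μ)
    (hasMajorant_shB i c Rr H hθ μ)

omit [CompleteSpace 𝔸] in
/-- ★ `conj b(σ_{−μ}) ≺ e^{θ}e^{−θd}` over `(toB6 (geoCK i □), blkBK)`. [cite: Balaban1984PropagatorsII, (2.51) p.232, (2.46) p.231; Balaban1985BackgroundPropagators, (3.8) p.392] -/
theorem hasMajorant_conj_shiftOpB' (Rr : ℝ) (H : Prop) {θ : ℝ} (hθ : 0 ≤ θ) (μ : Fin (d + 1)) :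
    HasMajorant (g := toB6 (geoCK i c) Rr H) (blkBK i c) (conj b ((shiftOpB' (𝔸 := 𝔸) i μ).restrictScalars ℝ))
      (fun a a' => Real.exp θ * Real.exp (-(θ * (geoCK i c).dist a a'))) :=
  hasMajorant_conj_of_liftY b (g := toB6 (geoCK i c) Rr H) (fun f : FBondY i => blkV1 i.hN (cubeFamY i c) f) _ _ (shiftOpB'_liftY i μ)
    (hasMajorant_shBi i c Rr H hθ μ)

/-- `|c_f| = η⁻¹` and `η⁻¹·(ω·(η·t)) = ω·t`: the unit bookkeeping of the multiplier sizes. [cite: Balaban1985BackgroundPropagators, (3.26) p.395, bookkeeping] -/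
theorem abs_cf_mul_eta_mul (ω t : ℝ) : |i.cf| * (ω * ((kGeo i).eta * t)) = ω * t := by
  have hη : (kGeo i).eta ≠ 0 := (B9BackgroundsKLevelV1.eta_pos_L_one_le_M_pos i).1.ne'
  rw [B9Ineq373HessianPieceBoundsY.abs_cf_eq]
  calc ((kGeo i).eta)⁻¹ * (ω * ((kGeo i).eta * t)) = (((kGeo i).eta)⁻¹ * (kGeo i).eta) * (ω * t) := by ring
    _ = ω * t := by rw [inv_mul_cancel₀ hη, one_mul]


omit [CompleteSpace 𝔸] in
/-- ★ **A DEFECT MULTIPLIER IS SITE-LOCAL OF SIZE `2ω∕η·`(window)**: if `W` is bi-contractive and `‖W(x) − 1‖ ≤ ω·η·t` for all `x` then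
`‖(mulOpB W X)(f)‖ ≤ 2ω·t·‖X(f)‖` (`‖R(W)a − a‖ ≤ 2‖W − 1‖‖a‖`, `|c_f| = η⁻¹`). [cite: Balaban1985BackgroundPropagators, (3.37) p.396, p.403 l.1–9; Balaban1985Variational, (135) p.298] -/
theorem norm_mulOpB_apply_le {W : Site (PV d ℓ i.m i.K hd hL) 0 → 𝔸ˣ} (hW : ∀ x, ‖(W x : 𝔸)‖ ≤ 1 ∧ ‖(((W x)⁻¹ : 𝔸ˣ) : 𝔸)‖ ≤ 1) {ω t : ℝ}
    (hWin : ∀ x, ‖(W x : 𝔸) - 1‖ ≤ ω * ((kGeo i).eta * t)) (X : FBondY i → 𝔸) (f : FBondY i) :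
    ‖mulOpB i W X f‖ ≤ 2 * ω * t * ‖X f‖ := by
  rw [mulOpB_apply, norm_smul, Complex.norm_real, Real.norm_eq_abs]
  have h := B11Eq135Weitzenbock.norm_R_sub_self_le (hW f.src).2 (X f)
  calc |i.cf| * ‖R (W f.src) (X f) - X f‖ ≤ |i.cf| * (2 * ‖(W f.src : 𝔸) - 1‖ * ‖X f‖) := mul_le_mul_of_nonneg_left h (abs_nonneg _)
    _ ≤ |i.cf| * (2 * (ω * ((kGeo i).eta * t)) * ‖X f‖) := by gcongr; exact hWin f.src
    _ = 2 * (|i.cf| * (ω * ((kGeo i).eta * t))) * ‖X f‖ := by ring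
    _ = 2 * ω * t * ‖X f‖ := by rw [abs_cf_mul_eta_mul]; ring

omit [CompleteSpace 𝔸] in
/-- the inverse-multiplier version (`‖R(u⁻¹)a − a‖ ≤ 2‖u − 1‖‖a‖` for bi-contractive `u`). [cite: Balaban1985BackgroundPropagators, (3.37) p.396, (3.8) p.392, p.403 l.1–9] -/
theorem norm_mulOpB_inv_apply_le {W : Site (PV d ℓ i.m i.K hd hL) 0 → 𝔸ˣ} (hW : ∀ x, ‖(W x : 𝔸)‖ ≤ 1 ∧ ‖(((W x)⁻¹ : 𝔸ˣ) : 𝔸)‖ ≤ 1) {ω t : ℝ}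
    (hWin : ∀ x, ‖(W x : 𝔸) - 1‖ ≤ ω * ((kGeo i).eta * t)) (X : FBondY i → 𝔸) (f : FBondY i) :
    ‖mulOpB i (fun x => (W x)⁻¹) X f‖ ≤ 2 * ω * t * ‖X f‖ := by
  rw [mulOpB_apply, norm_smul, Complex.norm_real, Real.norm_eq_abs]
  have h := norm_Rinv_sub_self_le (hW f.src) (X f)
  calc |i.cf| * ‖R (W f.src)⁻¹ (X f) - X f‖ ≤ |i.cf| * (2 * ‖(W f.src : 𝔸) - 1‖ * ‖X f‖) := mul_le_mul_of_nonneg_left h (abs_nonneg _)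
    _ ≤ |i.cf| * (2 * (ω * ((kGeo i).eta * t)) * ‖X f‖) := by gcongr; exact hWin f.src
    _ = 2 * (|i.cf| * (ω * ((kGeo i).eta * t))) * ‖X f‖ := by ring
    _ = 2 * ω * t * ‖X f‖ := by rw [abs_cf_mul_eta_mul]; ring

/-- ★ **THE DIFFERENCE QUOTIENT OF THE MULTIPLIER IS SITE-LOCAL OF SIZE `2ω·t²`**: for bi-contractive `W` with the VARIATION window `‖W(x − e_μ) − W(x)‖ ≤ ω(ηt)²`,
`‖(c_f(F′_μ − F_μ)X)(f)‖ ≤ 2ω·t²·‖X(f)‖` (`‖R(u)a − R(u′)a‖ ≤ 2‖u − u′‖‖a‖`, `c_f² = η⁻²`). [cite: Balaban1985BackgroundPropagators, (3.37) p.396 (the `∇A` condition), (3.73) p.405, (3.100) p.413] -/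
theorem norm_mulDiff_apply_le {V : CfgY 𝔸 i} (hU : ∀ μ x, ‖(V μ x : 𝔸)‖ ≤ 1 ∧ ‖(((V μ x)⁻¹ : 𝔸ˣ) : 𝔸)‖ ≤ 1) (μ : Fin (d + 1)) {ω t : ℝ}
    (hWin : ∀ x, ‖(V μ (x.unshift μ) : 𝔸) - V μ x‖ ≤ ω * ((kGeo i).eta * t) ^ 2) (X : FBondY i → 𝔸) (f : FBondY i) :
    ‖((i.cf : ℝ) • (mulDefBF' i V μ - mulDefBF i V μ)) X f‖ ≤ 2 * ω * t ^ 2 * ‖X f‖ := by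
  rw [LinearMap.smul_apply, Pi.smul_apply, LinearMap.sub_apply, Pi.sub_apply, mulOpB_apply, mulOpB_apply, ← smul_sub, norm_smul, norm_smul,
    Complex.norm_real, Real.norm_eq_abs]
  have e : R (V μ (f.src.unshift μ)) (X f) - X f - (R (V μ f.src) (X f) - X f) = R (V μ (f.src.unshift μ)) (X f) - R (V μ f.src) (X f) := by abel
  rw [e]
  have h := norm_R_sub_R_le (hU μ (f.src.unshift μ)) (hU μ f.src) (X f)
  have hη : (kGeo i).eta ≠ 0 := (B9BackgroundsKLevelV1.eta_pos_L_one_le_M_pos i).1.ne'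
  calc |i.cf| * (|i.cf| * ‖R (V μ (f.src.unshift μ)) (X f) - R (V μ f.src) (X f)‖)
      ≤ |i.cf| * (|i.cf| * (2 * ‖(V μ (f.src.unshift μ) : 𝔸) - V μ f.src‖ * ‖X f‖)) := by gcongr
    _ ≤ |i.cf| * (|i.cf| * (2 * (ω * ((kGeo i).eta * t) ^ 2) * ‖X f‖)) := by gcongr; exact hWin f.src
    _ = (((kGeo i).eta)⁻¹ * (kGeo i).eta) ^ 2 * (2 * ω * t ^ 2 * ‖X f‖) := by rw [B9Ineq373HessianPieceBoundsY.abs_cf_eq]; ring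
    _ = 2 * ω * t ^ 2 * ‖X f‖ := by rw [inv_mul_cancel₀ hη, one_pow, one_mul]

end Sizes

/-! ## §3  ★★★ Corollary 3.6 at one cover cube: the (3.42) entries of `G_□(Ṽ_□)` WITH THE COVARIANT BOND DERIVATIVES AT `Ṽ_□`, over the cube sequence's blocks -/

section Main

variable (b : Module.Basis ι ℝ 𝔸)

omit [CompleteSpace 𝔸] in
/-- `conj b` of a finite sum. [cite: Balaban1984PropagatorsII, (2.52) p.232 («A summation preserves it also»), bookkeeping] -/
theorem conj_sum' {S : Type} {κ : Type} (s : Finset κ) (T : κ → Module.End ℝ (S → 𝔸)) : conj b (∑ k ∈ s, T k) = ∑ k ∈ s, conj b (T k) :=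
  map_sum (coordEquiv b).conj T s

omit [CompleteSpace 𝔸] in
/-- `conj b (r • T) = r • conj b T`. [cite: Balaban1984PropagatorsII, (2.52) p.232, bookkeeping] -/
theorem conj_smul' {S : Type} (r : ℝ) (T : Module.End ℝ (S → 𝔸)) : conj b (r • T) = r • conj b T := map_smul (coordEquiv b).conj r T

variable [NormOneClass 𝔸] [DecidableEq ι]

set_option maxHeartbeats 3200000 in
/-- ★★★ **COROLLARY 3.6 AT ONE COVER CUBE — THE (3.42) ENTRIES OF `G_□(Ṽ_□)` WITH THE COVARIANT DERIVATIVES AT `Ṽ_□`, BOTH LEFT FIRST-ORDER ENTRIES** (v1.1 of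
`cor36_G_cube_entries_at_locCfg` below, which is its projection): the same thresholds and hypotheses, and the conclusion carries ALSO the LEFT BACKWARD entry
`conj b(∇*_{Ṽ,ν})·G ≺ B_f·Lⁿη·e^{−δd}` (all `ν`) — by `∇*_{1,ν} = −σ_{−ν}∇_{1,ν}` (`cdsBₗ_one_eq_neg`) and `∇*_{Ṽ,ν} = ∇*_{1,ν} + B_νσ_{−ν}` it is the translated
forward flat entry plus a row-local correction, exactly as the forward one. Print uses both orientations of the first-order entries of (3.42) («all k ∈ κ ⊕ κ»); the
member-level Laplacian's lattice Leibniz rule through the cut-off `h_□` (`Node00.lapB_cutMulY_apply`) produces `∇*_{Ṽ,μ}G_□` terms, whence the need.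
[cite: Balaban1985BackgroundPropagators, Cor. 3.6 p.408 l.1–10, Thm 3.3 p.399, Thm 3.1 (3.42) p.397 (all first-order covariant derivatives, both orientations), p.403 l.1–9,
(3.70) p.404, (3.100) p.413; Balaban1984PropagatorsII, (2.51)–(2.55) p.232, Lemma 2.1 (2.60)–(2.63) p.234] -/
theorem cor36_G_cube_entries_at_locCfg' (hℓ : 1 ≤ ℓ) (hb₀ : 0 < b₀) (hb₁ : b₀ ≤ b₁) (M₂ : ℝ) (hM₂ : 0 ≤ M₂)
    (hrepr : ∀ (v : 𝔸) (j : ι), |b.repr v j| ≤ M₂ * ‖v‖) :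
    ∃ δ Bf M₀ T₀ : ℝ, ∃ N₀ : ℕ, 0 < δ ∧ 0 ≤ Bf ∧ ∃ a₁ : ℝ, 0 < a₁ ∧
    ∀ (i : KIdx d ℓ hd hL b₀ b₁) (c : ↥(cubes (toKT i).D.toDomains)) (Rr : ℝ) (H : Prop),
      M₀ ≤ ((ℓ : ℝ) + 1) * (toKT i).Mh → N₀ + 1 ≤ (toKT i).R * ((ℓ + 1) * (toKT i).Mh) → T₀ ≤ RM1 i →
    ∀ (A : AfldY 𝔸 i) (Q : Set (Site (PV d ℓ i.m i.K hd hL) 0)) (C ξ Λ : ℝ),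
      0 ≤ C → 0 < ξ → 1 ≤ Λ → ξ ≤ 5 * (SC i c : ℝ) * (kGeo i).eta → LatticeNorms.scaleLen ((ℓ : ℝ) + 1) (kGeo i).eta (c.1.1 + 1) ≤ Λ * ξ →
      (∀ x : Site (PV d ℓ i.m i.K hd hL) 0, NearC i c (35 * SC i c / 8 + 1) (boxEquiv i.hN x).1 → x ∈ Q) →
      (∀ κ, ∀ x ∈ Q, ‖A κ x‖ ≤ C * ξ⁻¹) →
      (∀ μ ν, ∀ x ∈ Q, ‖(((kGeo i).eta : ℂ)⁻¹) • covD (shiftsV1 (PV d ℓ i.m i.K hd hL)) (fun _ _ => (1 : 𝔸ˣ)) μ (A ν) x‖ ≤ C * (ξ ^ 2)⁻¹) →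
      (∀ (t : ℝ) (κ : Fin (d + 1)) (x : Site (PV d ℓ i.m i.K hd hL) 0), ‖NormedSpace.exp ((I * (t : ℂ)) • A κ x)‖ ≤ 1) →
      sRead C Λ ≤ a₁ →
      IsUnit (deltaACubeY i c (parSymY i) (parBY i) (locCfgY i c (kGeo i).eta A)) ∧
      HasMajorant (g := toB6 (geoCK i c) Rr H) (blkBK i c) (GVK b i c (parSymY i) (parBY i) (locCfgY i c (kGeo i).eta A))
        (fun a a' => Bf * (geoCK i c).len a ^ 2 * Real.exp (-(δ * (geoCK i c).dist a a'))) ∧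
      (∀ ν : Fin (d + 1), HasMajorant (g := toB6 (geoCK i c) Rr H) (blkBK i c)
        (conj b (cdBₗ i (locCfgY i c (kGeo i).eta A) ν) * GVK b i c (parSymY i) (parBY i) (locCfgY i c (kGeo i).eta A))
        (fun a a' => Bf * (geoCK i c).len a * Real.exp (-(δ * (geoCK i c).dist a a')))) ∧
      (∀ ν : Fin (d + 1), HasMajorant (g := toB6 (geoCK i c) Rr H) (blkBK i c)
        (conj b (cdsBₗ i (locCfgY i c (kGeo i).eta A) ν) * GVK b i c (parSymY i) (parBY i) (locCfgY i c (kGeo i).eta A))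
        (fun a a' => Bf * (geoCK i c).len a * Real.exp (-(δ * (geoCK i c).dist a a')))) ∧
      HasMajorant (g := toB6 (geoCK i c) Rr H) (blkBK i c)
        (conj b (lapBₗ i (locCfgY i c (kGeo i).eta A)) * GVK b i c (parSymY i) (parBY i) (locCfgY i c (kGeo i).eta A))
        (fun a a' => Bf * 1 * Real.exp (-(δ * (geoCK i c).dist a a'))) ∧
      (∀ (ν : Fin (d + 1)) (B₂ ρ' : ℝ), 0 ≤ B₂ → 0 ≤ ρ' → ρ' ≤ δ →
        HasMajorant (g := toB6 (geoCK i c) Rr H) (blkBK i c)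
          (GVK b i c (parSymY i) (parBY i) (locCfgY i c (kGeo i).eta A) * conj b (cdsBₗ i (fun _ _ => (1 : 𝔸ˣ)) ν))
          (fun a a' => B₂ * (geoCK i c).len a * Real.exp (-(ρ' * (geoCK i c).dist a a'))) →
        HasMajorant (g := toB6 (geoCK i c) Rr H) (blkBK i c)
          (GVK b i c (parSymY i) (parBY i) (locCfgY i c (kGeo i).eta A) * conj b (cdsBₗ i (locCfgY i c (kGeo i).eta A) ν))
          (fun a a' => (B₂ + Bf) * (geoCK i c).len a * Real.exp (-(ρ' * (geoCK i c).dist a a')))) := by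
  classical
  have hSb : 0 ≤ M₂ * ∑ j, ‖b j‖ := mul_nonneg hM₂ (Finset.sum_nonneg fun j _ => norm_nonneg _)
  obtain ⟨ρ, θ, M₀, T₀, N₀, hρ, hθ, a₁, ha₁, AG, hAG, h⟩ := cor36_G_cube_at_locCfg' b hℓ hb₀ hb₁ M₂ hM₂ hrepr
  -- the rates: transferred entries at `ρ₁ = (1 − κ)ρ`; shift corrections at `δ_f = (1 − κ)²ρ₁`, `κ = 9∕5000`
  have hρ₁ : 0 < (1 - 9 / 5000) * ρ := by positivity
  obtain ⟨dB, h261⟩ := exists_h261_geoCK d ℓ (δ₀ := (1 - 9 / 5000) * ((1 - 9 / 5000) * ρ)) (by positivity)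
  -- the constants
  set Sb : ℝ := M₂ * ∑ j, ‖b j‖ with hSbdef
  set A₁ : ℝ := AG * θ with hA₁def
  set Λ4 : ℝ := ((ℓ : ℝ) + 1) ^ 4 with hΛ4def
  have hA₁ : 0 ≤ A₁ := mul_nonneg hAG hθ
  have hΛ4 : 0 ≤ Λ4 := by positivity
  have hBf : 0 ≤ A₁ + Real.exp ((1 - 9 / 5000) * ρ) * A₁ * Λ4 * B6.c1 dB ((1 - 9 / 5000) * ((1 - 9 / 5000) * ρ)) (9 / 5000) ^ 2 +
      2 * Sb * Real.exp ((1 - 9 / 5000) * ρ) * A₁ * Λ4 * B6.c1 dB ((1 - 9 / 5000) * ((1 - 9 / 5000) * ρ)) (9 / 5000) ^ 2 +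
      ((d : ℝ) + 1) * (2 * Sb * A₁ + 2 * (2 * Sb * Real.exp ((1 - 9 / 5000) * ρ) * A₁ * Λ4 * B6.c1 dB ((1 - 9 / 5000) * ((1 - 9 / 5000) * ρ)) (9 / 5000) ^ 2) +
        4 * Sb ^ 2 * A₁) := by positivity
  refine ⟨(1 - 9 / 5000) * ((1 - 9 / 5000) * ((1 - 9 / 5000) * ρ)), _, M₀, max T₀ (4 * Real.log ((ℓ : ℝ) + 1) / (9 / 5000 * ((1 - 9 / 5000) * ρ))),
    max N₀ (N1 d ℓ (9 / 5000 * ((1 - 9 / 5000) * ((1 - 9 / 5000) * ρ)))), by positivity, hBf, min a₁ (1 / 120), lt_min ha₁ (by norm_num), ?_⟩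
  intro i c Rr H hM hN hT A Q C ξ Λ hC hξ hΛ hξS hΛξ hQ hA hdA hAu hsa
  have hN₀ : N₀ + 1 ≤ (toKT i).R * ((ℓ + 1) * (toKT i).Mh) := le_trans (Nat.succ_le_succ (le_max_left _ _)) hN
  have hN₁ : N1 d ℓ (9 / 5000 * ((1 - 9 / 5000) * ((1 - 9 / 5000) * ρ))) + 1 ≤ (toKT i).R * ((ℓ + 1) * (toKT i).Mh) :=
    le_trans (Nat.succ_le_succ (le_max_right _ _)) hN
  have hT₀ : T₀ ≤ RM1 i := (le_max_left _ _).trans hT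
  have hT₁ : 4 * Real.log ((ℓ : ℝ) + 1) / (9 / 5000 * ((1 - 9 / 5000) * ρ)) ≤ RM1 i := (le_max_right _ _).trans hT
  have hsa₁ : sRead C Λ ≤ a₁ := hsa.trans (min_le_left _ _)
  have hs120 : sRead C Λ ≤ 1 / 120 := hsa.trans (min_le_right _ _)
  obtain ⟨hunit, -, -, -, e0, e1, e3⟩ := h i c Rr H hM hN₀ hT₀ A Q C ξ Λ hC hξ hΛ hξS hΛξ hQ hA hdA hAu hsa₁
  -- abbreviations
  set ρ₁ : ℝ := (1 - 9 / 5000) * ρ with hρ₁def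
  set c1 : ℝ := B6.c1 dB ((1 - 9 / 5000) * ρ₁) (9 / 5000) with hc1def
  set K₀ : ℝ := Real.exp ρ₁ * A₁ * Λ4 * c1 ^ 2 with hK₀def
  set K₁ : ℝ := 2 * Sb * Real.exp ρ₁ * A₁ * Λ4 * c1 ^ 2 with hK₁def
  set Bf : ℝ := A₁ + K₀ + K₁ + ((d : ℝ) + 1) * (2 * Sb * A₁ + 2 * K₁ + 4 * Sb ^ 2 * A₁) with hBfdef
  have hc1 : 0 ≤ c1 := c1_nonneg _ _ _
  have hK₀ : 0 ≤ K₀ := by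
    rw [hK₀def]; exact mul_nonneg (mul_nonneg (mul_nonneg (Real.exp_nonneg _) hA₁) hΛ4) (sq_nonneg _)
  have hK₁ : 0 ≤ K₁ := by
    rw [hK₁def]; exact mul_nonneg (mul_nonneg (mul_nonneg (mul_nonneg (mul_nonneg (by norm_num) hSb) (Real.exp_nonneg _)) hA₁) hΛ4) (sq_nonneg _)
  have hBf' : 0 ≤ Bf := by
    have h1 := mul_nonneg hSb hA₁; have h2 := mul_nonneg (sq_nonneg Sb) hA₁
    have h3 : 0 ≤ ((d : ℝ) + 1) * (2 * Sb * A₁ + 2 * K₁ + 4 * Sb ^ 2 * A₁) := mul_nonneg (by positivity) (by linarith)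
    rw [hBfdef]; linarith
  set δf : ℝ := (1 - 9 / 5000) * ((1 - 9 / 5000) * ρ₁) with hδfdef
  have hδf : 0 < δf := by rw [hδfdef]; positivity
  have hδfρ₁ : δf ≤ ρ₁ := by rw [hδfdef]; nlinarith
  set η : ℝ := (kGeo i).eta with hηdef
  have hη : 0 < η := (B9BackgroundsKLevelV1.eta_pos_L_one_le_M_pos i).1
  set V := locCfgY i c η A with hVdef
  set G := GVK b i c (parSymY i) (parBY i) V with hGdef
  haveI : Nonempty (geoCK i c).Site := geoCK_site_nonempty i c
  obtain ⟨hdnn, htri, hrefl, -⟩ := geoCK_dist_axioms i c Rr H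
  have hlen0 : ∀ a : BlkCubeY i c, 0 ≤ (geoCK i c).len a := fun a => (geoCK_len_pos i c a).le
  have hlen2 : ∀ a : BlkCubeY i c, 0 ≤ (geoCK i c).len a ^ 2 := fun a => sq_nonneg _
  -- the size `s`, the window constant `α_W(s) ≤ 1`
  set s : ℝ := sRead C Λ with hsdef
  have hs0 : 0 ≤ s := sRead_nonneg hC Λ
  set αW : ℝ := alphaW s with hαWdef
  have hαW0 : 0 ≤ αW := alphaW_nonneg hs0
  have hαW1 : αW ≤ 1 := by
    have h60 := alphaW_le_sixty_mul hs0 (hs120.trans (by norm_num))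
    rw [hαWdef]; linarith
  -- the windows, uniformly on the torus, at any block's length
  have hU := unitaryLike_locCfgY i c hAu η
  have hW1 : ∀ (a : BlkCubeY i c) (κ : Fin (d + 1)) (y : Site (PV d ℓ i.m i.K hd hL) 0), ‖(V κ y : 𝔸) - 1‖ ≤ αW * (η * ((geoCK i c).len a)⁻¹) := by
    intro a κ y
    obtain ⟨h1, h2⟩ := len_bounds i c hΛξ a
    refine (norm_locCfgY_sub_one_le i c hC hξ hΛ hξS hQ hA hdA h1 h2 κ y).trans ?_
    exact mul_le_mul_of_nonneg_right (mul_exp_le_alphaW hs0) (by have := geoCK_len_pos i c a; positivity)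
  have hW2 : ∀ (a : BlkCubeY i c) (κ μ : Fin (d + 1)) (y : Site (PV d ℓ i.m i.K hd hL) 0),
      ‖(V κ (y.unshift μ) : 𝔸) - V κ y‖ ≤ αW * (η * ((geoCK i c).len a)⁻¹) ^ 2 := by
    intro a κ μ y
    obtain ⟨h1, h2⟩ := len_bounds i c hΛξ a
    rw [norm_sub_rev]
    refine (norm_locCfgY_sub_unshift_le i c hC hξ hΛ hξS hQ hA hdA h1 h2 κ μ y).trans ?_
    exact mul_le_mul_of_nonneg_right (mul_exp_le_alphaW hs0) (sq_nonneg _)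
  -- ROW-LOCALITY of the multipliers (coefficient `2α_W·len(a)⁻¹·(M₂Σ‖b‖) ≤ 2·Sb·len(a)⁻¹`) and of the difference quotient (`2·Sb·(len(a)²)⁻¹`)
  have hcF : ∀ a : BlkCubeY i c, 0 ≤ 2 * ((geoCK i c).len a)⁻¹ * Sb := fun a => mul_nonneg (mul_nonneg (by norm_num) (inv_nonneg.2 (hlen0 a))) hSb
  have hloc_of : ∀ (T : Module.End ℝ (FBondY i → 𝔸)) (t : BlkCubeY i c → ℝ), (∀ a, 0 ≤ t a) →
      (∀ (X : FBondY i → 𝔸) (f : FBondY i), ‖T X f‖ ≤ 2 * αW * t (blkV1 i.hN (cubeFamY i c) f) * ‖X f‖) →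
      ∀ (w : FBondY i × ι → ℝ) (p : FBondY i × ι) (M : ℝ), (∀ p' : FBondY i × ι, blkBK i c p' = blkBK i c p → |w p'| ≤ M) →
        |conj b T w p| ≤ 2 * t (blkBK i c p) * Sb * M := by
    intro T t ht hT w p M hw
    have h := rowLocal_conj_of_local b (fun f : FBondY i => blkV1 i.hN (cubeFamY i c) f) (fun a => 2 * t a) hM₂ hrepr T
      (fun X f Bf' hBf' => (hT X f).trans (by
        have hXf : ‖X f‖ ≤ Bf' := hBf' f rfl
        have h2t : 0 ≤ 2 * t (blkV1 i.hN (cubeFamY i c) f) := mul_nonneg (by norm_num) (ht _)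
        calc 2 * αW * t (blkV1 i.hN (cubeFamY i c) f) * ‖X f‖ = αW * (2 * t (blkV1 i.hN (cubeFamY i c) f) * ‖X f‖) := by ring
          _ ≤ 1 * (2 * t (blkV1 i.hN (cubeFamY i c) f) * ‖X f‖) := mul_le_mul_of_nonneg_right hαW1 (mul_nonneg h2t (norm_nonneg _))
          _ ≤ 1 * (2 * t (blkV1 i.hN (cubeFamY i c) f) * Bf') := by rw [one_mul, one_mul]; exact mul_le_mul_of_nonneg_left hXf h2t
          _ = 2 * t (blkV1 i.hN (cubeFamY i c) f) * Bf' := one_mul _)) w p M hw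
    calc |conj b T w p| ≤ 2 * t (blkV1 i.hN (cubeFamY i c) p.1) * (M₂ * ∑ j, ‖b j‖) * M := h
      _ = 2 * t (blkBK i c p) * Sb * M := by rw [hSbdef]
  have hlocF : ∀ μ, ∀ (w : FBondY i × ι → ℝ) (p : FBondY i × ι) (M : ℝ), (∀ p' : FBondY i × ι, blkBK i c p' = blkBK i c p → |w p'| ≤ M) →
      |conj b (mulDefBF i V μ) w p| ≤ 2 * ((geoCK i c).len (blkBK i c p))⁻¹ * Sb * M := fun μ =>
    hloc_of _ (fun a => ((geoCK i c).len a)⁻¹) (fun a => inv_nonneg.2 (hlen0 a)) fun X f =>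
      norm_mulOpB_apply_le i (W := V μ) (fun x => hU μ x) (fun x => hW1 _ μ x) X f
  have hlocF' : ∀ μ, ∀ (w : FBondY i × ι → ℝ) (p : FBondY i × ι) (M : ℝ), (∀ p' : FBondY i × ι, blkBK i c p' = blkBK i c p → |w p'| ≤ M) →
      |conj b (mulDefBF' i V μ) w p| ≤ 2 * ((geoCK i c).len (blkBK i c p))⁻¹ * Sb * M := fun μ =>
    hloc_of _ (fun a => ((geoCK i c).len a)⁻¹) (fun a => inv_nonneg.2 (hlen0 a)) fun X f =>
      norm_mulOpB_apply_le i (W := fun x => V μ (x.unshift μ)) (fun x => hU μ _) (fun x => hW1 _ μ _) X f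
  have hlocB : ∀ μ, ∀ (w : FBondY i × ι → ℝ) (p : FBondY i × ι) (M : ℝ), (∀ p' : FBondY i × ι, blkBK i c p' = blkBK i c p → |w p'| ≤ M) →
      |conj b (mulDefBB i V μ) w p| ≤ 2 * ((geoCK i c).len (blkBK i c p))⁻¹ * Sb * M := fun μ =>
    hloc_of _ (fun a => ((geoCK i c).len a)⁻¹) (fun a => inv_nonneg.2 (hlen0 a)) fun X f =>
      norm_mulOpB_inv_apply_le i (W := fun x => V μ (x.unshift μ)) (fun x => hU μ _) (fun x => hW1 _ μ _) X f
  have hlocE : ∀ μ, ∀ (w : FBondY i × ι → ℝ) (p : FBondY i × ι) (M : ℝ), (∀ p' : FBondY i × ι, blkBK i c p' = blkBK i c p → |w p'| ≤ M) →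
      |conj b ((i.cf : ℝ) • (mulDefBF' i V μ - mulDefBF i V μ)) w p| ≤ 2 * ((geoCK i c).len (blkBK i c p) ^ 2)⁻¹ * Sb * M := fun μ =>
    hloc_of _ (fun a => ((geoCK i c).len a ^ 2)⁻¹) (fun a => inv_nonneg.2 (hlen2 a)) fun X f => by
      have h := norm_mulDiff_apply_le i hU μ (fun x => hW2 (blkV1 i.hN (cubeFamY i c) f) μ μ x) X f
      rw [inv_pow] at h
      exact h
  -- [4] Lemma 2.1 at `((1−κ)ρ₁, κ)`; the scale transfers at `(ρ₁, κ)`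
  have h261' : Ineq261 dB (toB6 (geoCK i c) Rr H) ((1 - 9 / 5000) * ρ₁) (9 / 5000) := h261 i c Rr H hN₁ (9 / 5000) le_rfl (by norm_num)
  obtain ⟨hST1, hST2, hST3, -, -, -⟩ := hST_geoCK i c hρ₁ hT₁ (9 / 5000) le_rfl
  have hPΛ1 : ∀ a e : BlkCubeY i c, Real.exp (-(9 / 5000 * ρ₁ * (geoCK i c).dist a e)) * (geoCK i c).len e ≤ Λ4 * (geoCK i c).len a := fun a e => hST1 a e
  have hPΛ2 : ∀ a e : BlkCubeY i c, Real.exp (-(9 / 5000 * ρ₁ * (geoCK i c).dist a e)) * (geoCK i c).len e ^ 2 ≤ Λ4 * (geoCK i c).len a ^ 2 := fun a e => hST2 a e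
  have hPΛ3 : ∀ a e : BlkCubeY i c, Real.exp (-(9 / 5000 * ρ₁ * (geoCK i c).dist a e)) * ((geoCK i c).len e)⁻¹ ≤ Λ4 * ((geoCK i c).len a)⁻¹ := fun a e => hST3 a e
  have hκρ : 0 ≤ 9 / 5000 * ρ₁ := by positivity
  have hκρ' : 0 ≤ (1 - 9 / 5000) * ρ₁ := by positivity
  -- the translations
  have hσ : ∀ μ, HasMajorant (g := toB6 (geoCK i c) Rr H) (blkBK i c) (conj b ((shiftOpB (𝔸 := 𝔸) i μ).restrictScalars ℝ))
      (fun a a' => Real.exp ρ₁ * Real.exp (-(ρ₁ * (geoCK i c).dist a a'))) := fun μ => hasMajorant_conj_shiftOpB i c b Rr H hρ₁.le μ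
  have hσ' : ∀ μ, HasMajorant (g := toB6 (geoCK i c) Rr H) (blkBK i c) (conj b ((shiftOpB' (𝔸 := 𝔸) i μ).restrictScalars ℝ))
      (fun a a' => Real.exp ρ₁ * Real.exp (-(ρ₁ * (geoCK i c).dist a a'))) := fun μ => hasMajorant_conj_shiftOpB' i c b Rr H hρ₁.le μ
  -- the transferred flat entries of G-F7 v1.1
  have E0 : HasMajorant (g := toB6 (geoCK i c) Rr H) (blkBK i c) G (fun a a' => A₁ * (geoCK i c).len a ^ 2 * Real.exp (-(ρ₁ * (geoCK i c).dist a a'))) := by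
    rw [hA₁def]; exact e0
  have E1 : ∀ ν, HasMajorant (g := toB6 (geoCK i c) Rr H) (blkBK i c) (DK b i ν * G) (fun a a' => A₁ * (geoCK i c).len a * Real.exp (-(ρ₁ * (geoCK i c).dist a a'))) := by
    rw [hA₁def]; exact e1
  have E3 : HasMajorant (g := toB6 (geoCK i c) Rr H) (blkBK i c) (LapK b i * G) (fun a a' => A₁ * 1 * Real.exp (-(ρ₁ * (geoCK i c).dist a a'))) := by
    rw [hA₁def]; exact e3
  -- SHIFTED ENTRIES: `σ_μ·G ≺ e^{ρ₁}A₁Λ4c₁²·len²·e^{−δ_f d}`, `σ_{−μ}·∇_μG ≺ e^{ρ₁}A₁Λ4c₁²·len·e^{−δ_f d}`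
  have hσG : ∀ μ, HasMajorant (g := toB6 (geoCK i c) Rr H) (blkBK i c) (conj b ((shiftOpB (𝔸 := 𝔸) i μ).restrictScalars ℝ) * G)
      (fun a a' => Real.exp ρ₁ * A₁ * Λ4 * c1 ^ 2 * (geoCK i c).len a ^ 2 * Real.exp (-(δf * (geoCK i c).dist a a'))) := fun μ =>
    hasMajorant_shift_mul_weighted i c Rr H (blkBK i c) dB (fun a => (geoCK i c).len a ^ 2) (Real.exp_nonneg _) hA₁ hΛ4 hlen2 hκρ hκρ' (by norm_num) htri
      hPΛ2 h261' (hσ μ) E0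
  have hσ'DG : ∀ μ, HasMajorant (g := toB6 (geoCK i c) Rr H) (blkBK i c) (conj b ((shiftOpB' (𝔸 := 𝔸) i μ).restrictScalars ℝ) * (DK b i μ * G))
      (fun a a' => Real.exp ρ₁ * A₁ * Λ4 * c1 ^ 2 * (geoCK i c).len a * Real.exp (-(δf * (geoCK i c).dist a a'))) := fun μ =>
    hasMajorant_shift_mul_weighted i c Rr H (blkBK i c) dB (fun a => (geoCK i c).len a) (Real.exp_nonneg _) hA₁ hΛ4 hlen0 hκρ hκρ' (by norm_num) htri
      hPΛ1 h261' (hσ' μ) (E1 μ)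
  have hσ'G : ∀ μ, HasMajorant (g := toB6 (geoCK i c) Rr H) (blkBK i c) (conj b ((shiftOpB' (𝔸 := 𝔸) i μ).restrictScalars ℝ) * G)
      (fun a a' => Real.exp ρ₁ * A₁ * Λ4 * c1 ^ 2 * (geoCK i c).len a ^ 2 * Real.exp (-(δf * (geoCK i c).dist a a'))) := fun μ =>
    hasMajorant_shift_mul_weighted i c Rr H (blkBK i c) dB (fun a => (geoCK i c).len a ^ 2) (Real.exp_nonneg _) hA₁ hΛ4 hlen2 hκρ hκρ' (by norm_num) htri
      hPΛ2 h261' (hσ' μ) E0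
  -- algebra of the weights
  have hlinv : ∀ a : BlkCubeY i c, ((geoCK i c).len a)⁻¹ * (geoCK i c).len a ^ 2 = (geoCK i c).len a := fun a => by
    have := (geoCK_len_pos i c a).ne'; field_simp
  have hlinv1 : ∀ a : BlkCubeY i c, ((geoCK i c).len a)⁻¹ * (geoCK i c).len a = 1 := fun a => inv_mul_cancel₀ (geoCK_len_pos i c a).ne'
  have hlinv2 : ∀ a : BlkCubeY i c, ((geoCK i c).len a ^ 2)⁻¹ * (geoCK i c).len a ^ 2 = 1 := fun a => inv_mul_cancel₀ (pow_ne_zero 2 (geoCK_len_pos i c a).ne')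
  have hexp0 : ∀ a a' : BlkCubeY i c, 0 ≤ Real.exp (-(δf * (geoCK i c).dist a a')) := fun a a' => Real.exp_nonneg _
  -- ENTRY 1, correction: `F_μ·σ_μ·G ≺ K₁·len·e^{−δ_f d}`
  have hT1b : ∀ μ, HasMajorant (g := toB6 (geoCK i c) Rr H) (blkBK i c) (conj b (mulDefBF i V μ) * (conj b ((shiftOpB (𝔸 := 𝔸) i μ).restrictScalars ℝ) * G))
      (fun a a' => K₁ * (geoCK i c).len a * Real.exp (-(δf * (geoCK i c).dist a a'))) := fun μ => by
    refine hasMajorant_mono (g := toB6 (geoCK i c) Rr H) _ (hasMajorant_mul_of_rowLocal (g := toB6 (geoCK i c) Rr H) (blkBK i c)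
      (fun a => 2 * ((geoCK i c).len a)⁻¹ * Sb) (hlocF μ) (hσG μ)) fun a a' => le_of_eq ?_
    calc 2 * ((geoCK i c).len a)⁻¹ * Sb * (Real.exp ρ₁ * A₁ * Λ4 * c1 ^ 2 * (geoCK i c).len a ^ 2 * Real.exp (-(δf * (geoCK i c).dist a a')))
        = 2 * Sb * Real.exp ρ₁ * A₁ * Λ4 * c1 ^ 2 * (((geoCK i c).len a)⁻¹ * (geoCK i c).len a ^ 2) * Real.exp (-(δf * (geoCK i c).dist a a')) := by ring
      _ = K₁ * (geoCK i c).len a * Real.exp (-(δf * (geoCK i c).dist a a')) := by rw [hlinv, hK₁def]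
  -- ENTRY 1 assembled
  have hEntry1 : ∀ ν, HasMajorant (g := toB6 (geoCK i c) Rr H) (blkBK i c) (conj b (cdBₗ i V ν) * G)
      (fun a a' => (A₁ + K₁) * (geoCK i c).len a * Real.exp (-(δf * (geoCK i c).dist a a'))) := fun ν => by
    have e : conj b (cdBₗ i V ν) * G = DK b i ν * G + conj b (mulDefBF i V ν) * (conj b ((shiftOpB (𝔸 := 𝔸) i ν).restrictScalars ℝ) * G) := by
      rw [cdBₗ_eq_add, conj_add', B9Eq352DivFormLetters.conj_mul, conj_cdBₗ_one, add_mul, mul_assoc]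
    rw [e]
    refine hasMajorant_mono (g := toB6 (geoCK i c) Rr H) _ (hasMajorant_add (g := toB6 (geoCK i c) Rr H) _
      (hasMajorant_weaken i c Rr H _ hlen0 le_rfl hA₁ hδfρ₁ (E1 ν)) (hT1b ν)) fun a a' => le_of_eq (by ring)
  -- ENTRY 1*, the LEFT BACKWARD derivative: `∇*_{Ṽ,μ}·G = −σ_{−μ}∇_μ·G + B_μσ_{−μ}·G ≺ (K₀ + K₁)·len·e^{−δ_f d}`
  have hT1s : ∀ μ, HasMajorant (g := toB6 (geoCK i c) Rr H) (blkBK i c) (conj b (mulDefBB i V μ) * (conj b ((shiftOpB' (𝔸 := 𝔸) i μ).restrictScalars ℝ) * G))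
      (fun a a' => K₁ * (geoCK i c).len a * Real.exp (-(δf * (geoCK i c).dist a a'))) := fun μ => by
    refine hasMajorant_mono (g := toB6 (geoCK i c) Rr H) _ (hasMajorant_mul_of_rowLocal (g := toB6 (geoCK i c) Rr H) (blkBK i c)
      (fun a => 2 * ((geoCK i c).len a)⁻¹ * Sb) (hlocB μ) (hσ'G μ)) fun a a' => le_of_eq ?_
    calc 2 * ((geoCK i c).len a)⁻¹ * Sb * (Real.exp ρ₁ * A₁ * Λ4 * c1 ^ 2 * (geoCK i c).len a ^ 2 * Real.exp (-(δf * (geoCK i c).dist a a')))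
        = 2 * Sb * Real.exp ρ₁ * A₁ * Λ4 * c1 ^ 2 * (((geoCK i c).len a)⁻¹ * (geoCK i c).len a ^ 2) * Real.exp (-(δf * (geoCK i c).dist a a')) := by ring
      _ = K₁ * (geoCK i c).len a * Real.exp (-(δf * (geoCK i c).dist a a')) := by rw [hlinv, hK₁def]
  have hEntry1s : ∀ ν, HasMajorant (g := toB6 (geoCK i c) Rr H) (blkBK i c) (conj b (cdsBₗ i V ν) * G)
      (fun a a' => (K₀ + K₁) * (geoCK i c).len a * Real.exp (-(δf * (geoCK i c).dist a a'))) := fun ν => by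
    have e : conj b (cdsBₗ i V ν) * G = -(conj b ((shiftOpB' (𝔸 := 𝔸) i ν).restrictScalars ℝ) * (DK b i ν * G)) +
        conj b (mulDefBB i V ν) * (conj b ((shiftOpB' (𝔸 := 𝔸) i ν).restrictScalars ℝ) * G) := by
      rw [cdsBₗ_eq_add, conj_add', B9Eq352DivFormLetters.conj_mul, cdsBₗ_one_eq_neg, conj_neg, B9Eq352DivFormLetters.conj_mul, conj_cdBₗ_one]
      refine LinearMap.ext fun w => ?_
      simp only [LinearMap.add_apply, LinearMap.neg_apply, Module.End.mul_apply]
    rw [e]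
    refine hasMajorant_mono (g := toB6 (geoCK i c) Rr H) _ (hasMajorant_add (g := toB6 (geoCK i c) Rr H) _
      (hasMajorant_neg (g := toB6 (geoCK i c) Rr H) _ (hσ'DG ν)) (hT1s ν)) fun a a' => le_of_eq (by rw [hK₀def]; ring)
  -- ENTRY 3, the four correction families per direction
  have hT3a : ∀ μ, HasMajorant (g := toB6 (geoCK i c) Rr H) (blkBK i c) (-(conj b (mulDefBF' i V μ) * (DK b i μ * G)))
      (fun a a' => 2 * Sb * A₁ * 1 * Real.exp (-(δf * (geoCK i c).dist a a'))) := fun μ => by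
    refine hasMajorant_neg (g := toB6 (geoCK i c) Rr H) _ (hasMajorant_mono (g := toB6 (geoCK i c) Rr H) _
      (hasMajorant_mul_of_rowLocal (g := toB6 (geoCK i c) Rr H) (blkBK i c) (fun a => 2 * ((geoCK i c).len a)⁻¹ * Sb) (hlocF' μ)
        (hasMajorant_weaken i c Rr H _ hlen0 le_rfl hA₁ hδfρ₁ (E1 μ))) fun a a' => le_of_eq ?_)
    calc 2 * ((geoCK i c).len a)⁻¹ * Sb * (A₁ * (geoCK i c).len a * Real.exp (-(δf * (geoCK i c).dist a a')))
        = 2 * Sb * A₁ * (((geoCK i c).len a)⁻¹ * (geoCK i c).len a) * Real.exp (-(δf * (geoCK i c).dist a a')) := by ring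
      _ = _ := by rw [hlinv1]
  have hT3b : ∀ μ, HasMajorant (g := toB6 (geoCK i c) Rr H) (blkBK i c)
      (conj b ((i.cf : ℝ) • (mulDefBF' i V μ - mulDefBF i V μ)) * (conj b ((shiftOpB (𝔸 := 𝔸) i μ).restrictScalars ℝ) * G))
      (fun a a' => K₁ * 1 * Real.exp (-(δf * (geoCK i c).dist a a'))) := fun μ => by
    refine hasMajorant_mono (g := toB6 (geoCK i c) Rr H) _ (hasMajorant_mul_of_rowLocal (g := toB6 (geoCK i c) Rr H) (blkBK i c)
      (fun a => 2 * ((geoCK i c).len a ^ 2)⁻¹ * Sb) (hlocE μ) (hσG μ)) fun a a' => le_of_eq ?_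
    calc 2 * ((geoCK i c).len a ^ 2)⁻¹ * Sb * (Real.exp ρ₁ * A₁ * Λ4 * c1 ^ 2 * (geoCK i c).len a ^ 2 * Real.exp (-(δf * (geoCK i c).dist a a')))
        = 2 * Sb * Real.exp ρ₁ * A₁ * Λ4 * c1 ^ 2 * (((geoCK i c).len a ^ 2)⁻¹ * (geoCK i c).len a ^ 2) * Real.exp (-(δf * (geoCK i c).dist a a')) := by ring
      _ = K₁ * 1 * Real.exp (-(δf * (geoCK i c).dist a a')) := by rw [hlinv2, hK₁def]
  have hT3c : ∀ μ, HasMajorant (g := toB6 (geoCK i c) Rr H) (blkBK i c)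
      (conj b (mulDefBB i V μ) * (conj b ((shiftOpB' (𝔸 := 𝔸) i μ).restrictScalars ℝ) * (DK b i μ * G)))
      (fun a a' => K₁ * 1 * Real.exp (-(δf * (geoCK i c).dist a a'))) := fun μ => by
    refine hasMajorant_mono (g := toB6 (geoCK i c) Rr H) _ (hasMajorant_mul_of_rowLocal (g := toB6 (geoCK i c) Rr H) (blkBK i c)
      (fun a => 2 * ((geoCK i c).len a)⁻¹ * Sb) (hlocB μ) (hσ'DG μ)) fun a a' => le_of_eq ?_
    calc 2 * ((geoCK i c).len a)⁻¹ * Sb * (Real.exp ρ₁ * A₁ * Λ4 * c1 ^ 2 * (geoCK i c).len a * Real.exp (-(δf * (geoCK i c).dist a a')))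
        = 2 * Sb * Real.exp ρ₁ * A₁ * Λ4 * c1 ^ 2 * (((geoCK i c).len a)⁻¹ * (geoCK i c).len a) * Real.exp (-(δf * (geoCK i c).dist a a')) := by ring
      _ = K₁ * 1 * Real.exp (-(δf * (geoCK i c).dist a a')) := by rw [hlinv1, hK₁def]
  have hT3d : ∀ μ, HasMajorant (g := toB6 (geoCK i c) Rr H) (blkBK i c) (conj b (mulDefBB i V μ) * (conj b (mulDefBF' i V μ) * G))
      (fun a a' => 4 * Sb ^ 2 * A₁ * 1 * Real.exp (-(δf * (geoCK i c).dist a a'))) := fun μ => by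
    have hin : HasMajorant (g := toB6 (geoCK i c) Rr H) (blkBK i c) (conj b (mulDefBF' i V μ) * G)
        (fun a a' => 2 * ((geoCK i c).len a)⁻¹ * Sb * (A₁ * (geoCK i c).len a ^ 2 * Real.exp (-(δf * (geoCK i c).dist a a')))) :=
      hasMajorant_mul_of_rowLocal (g := toB6 (geoCK i c) Rr H) (blkBK i c) (fun a => 2 * ((geoCK i c).len a)⁻¹ * Sb) (hlocF' μ)
        (hasMajorant_weaken i c Rr H _ hlen2 le_rfl hA₁ hδfρ₁ E0)
    refine hasMajorant_mono (g := toB6 (geoCK i c) Rr H) _ (hasMajorant_mul_of_rowLocal (g := toB6 (geoCK i c) Rr H) (blkBK i c)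
      (fun a => 2 * ((geoCK i c).len a)⁻¹ * Sb) (hlocB μ) hin) fun a a' => le_of_eq ?_
    calc 2 * ((geoCK i c).len a)⁻¹ * Sb * (2 * ((geoCK i c).len a)⁻¹ * Sb * (A₁ * (geoCK i c).len a ^ 2 * Real.exp (-(δf * (geoCK i c).dist a a'))))
        = 4 * Sb ^ 2 * A₁ * (((geoCK i c).len a)⁻¹ * (((geoCK i c).len a)⁻¹ * (geoCK i c).len a ^ 2)) * Real.exp (-(δf * (geoCK i c).dist a a')) := by ring
      _ = 4 * Sb ^ 2 * A₁ * 1 * Real.exp (-(δf * (geoCK i c).dist a a')) := by rw [hlinv, hlinv1]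
  -- ENTRY 3, the correction per direction
  have hT3 : ∀ μ, HasMajorant (g := toB6 (geoCK i c) Rr H) (blkBK i c)
      (conj b (-(mulDefBF' i V μ * cdBₗ i (fun _ _ => 1) μ) + ((i.cf : ℝ) • (mulDefBF' i V μ - mulDefBF i V μ)) * (shiftOpB i μ).restrictScalars ℝ +
          mulDefBB i V μ * (shiftOpB' i μ).restrictScalars ℝ * cdBₗ i (fun _ _ => 1) μ + mulDefBB i V μ * mulDefBF' i V μ) * G)
      (fun a a' => (2 * Sb * A₁ + 2 * K₁ + 4 * Sb ^ 2 * A₁) * 1 * Real.exp (-(δf * (geoCK i c).dist a a'))) := fun μ => by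
    have e : conj b (-(mulDefBF' i V μ * cdBₗ i (fun _ _ => 1) μ) + ((i.cf : ℝ) • (mulDefBF' i V μ - mulDefBF i V μ)) * (shiftOpB i μ).restrictScalars ℝ +
          mulDefBB i V μ * (shiftOpB' i μ).restrictScalars ℝ * cdBₗ i (fun _ _ => 1) μ + mulDefBB i V μ * mulDefBF' i V μ) * G =
        -(conj b (mulDefBF' i V μ) * (DK b i μ * G)) +
          conj b ((i.cf : ℝ) • (mulDefBF' i V μ - mulDefBF i V μ)) * (conj b ((shiftOpB (𝔸 := 𝔸) i μ).restrictScalars ℝ) * G) +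
          conj b (mulDefBB i V μ) * (conj b ((shiftOpB' (𝔸 := 𝔸) i μ).restrictScalars ℝ) * (DK b i μ * G)) +
          conj b (mulDefBB i V μ) * (conj b (mulDefBF' i V μ) * G) := by
      rw [conj_add', conj_add', conj_add', conj_neg, B9Eq352DivFormLetters.conj_mul, B9Eq352DivFormLetters.conj_mul, B9Eq352DivFormLetters.conj_mul,
        B9Eq352DivFormLetters.conj_mul, B9Eq352DivFormLetters.conj_mul, conj_cdBₗ_one]
      refine LinearMap.ext fun w => ?_
      simp only [LinearMap.add_apply, LinearMap.neg_apply, Module.End.mul_apply]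
    rw [e]
    refine hasMajorant_mono (g := toB6 (geoCK i c) Rr H) _ (hasMajorant_add (g := toB6 (geoCK i c) Rr H) _
      (hasMajorant_add (g := toB6 (geoCK i c) Rr H) _ (hasMajorant_add (g := toB6 (geoCK i c) Rr H) _ (hT3a μ) (hT3b μ)) (hT3c μ)) (hT3d μ))
      fun a a' => le_of_eq (by ring)
  -- ENTRY 3 assembled
  have hEntry3 : HasMajorant (g := toB6 (geoCK i c) Rr H) (blkBK i c) (conj b (lapBₗ i V) * G)
      (fun a a' => Bf * 1 * Real.exp (-(δf * (geoCK i c).dist a a'))) := by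
    have hop : lapBₗ i V = lapBₗ i (fun _ _ => 1) +
        ∑ μ, (-(mulDefBF' i V μ * cdBₗ i (fun _ _ => 1) μ) + ((i.cf : ℝ) • (mulDefBF' i V μ - mulDefBF i V μ)) * (shiftOpB i μ).restrictScalars ℝ +
          mulDefBB i V μ * (shiftOpB' i μ).restrictScalars ℝ * cdBₗ i (fun _ _ => 1) μ + mulDefBB i V μ * mulDefBF' i V μ) := by
      rw [lapBₗ_eq_sum, lapBₗ_eq_sum, ← Finset.sum_add_distrib]
      exact Finset.sum_congr rfl fun μ _ => cdsBₗ_mul_cdBₗ_eq i V μ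
    have e : conj b (lapBₗ i V) * G = LapK b i * G +
        ∑ μ, conj b (-(mulDefBF' i V μ * cdBₗ i (fun _ _ => 1) μ) + ((i.cf : ℝ) • (mulDefBF' i V μ - mulDefBF i V μ)) * (shiftOpB i μ).restrictScalars ℝ +
          mulDefBB i V μ * (shiftOpB' i μ).restrictScalars ℝ * cdBₗ i (fun _ _ => 1) μ + mulDefBB i V μ * mulDefBF' i V μ) * G := by
      rw [hop, conj_add', conj_lapBₗ_one, conj_sum', add_mul, Finset.sum_mul]
    rw [e]
    have hsum := hasMajorant_finset_sum (g := toB6 (geoCK i c) Rr H) (blkBK i c) Finset.univ _ _ fun μ _ => hT3 μ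
    refine hasMajorant_mono (g := toB6 (geoCK i c) Rr H) _ (hasMajorant_add (g := toB6 (geoCK i c) Rr H) _
      (hasMajorant_weaken i c Rr H (fun _ => (1 : ℝ)) (fun _ => zero_le_one) le_rfl hA₁ hδfρ₁ E3) hsum) fun a a' => ?_
    rw [Finset.sum_const, Finset.card_univ, Fintype.card_fin, nsmul_eq_mul, Nat.cast_add, Nat.cast_one, hBfdef]
    have hx : 0 ≤ Real.exp (-(δf * (geoCK i c).dist a a')) := Real.exp_nonneg _
    nlinarith
  -- ENTRY 2, the correction `G·B_ν·σ_{−ν} ≺ K₁·len·e^{−δ_f d}` (weighted-kernel∘shift rule)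
  have hT2 : ∀ ν, HasMajorant (g := toB6 (geoCK i c) Rr H) (blkBK i c) (G * conj b (mulDefBB i V ν) * conj b ((shiftOpB' (𝔸 := 𝔸) i ν).restrictScalars ℝ))
      (fun a a' => K₁ * (geoCK i c).len a * Real.exp (-(δf * (geoCK i c).dist a a'))) := fun ν => by
    have hin : HasMajorant (g := toB6 (geoCK i c) Rr H) (blkBK i c) (G * conj b (mulDefBB i V ν))
        (fun a a' => A₁ * (geoCK i c).len a ^ 2 * Real.exp (-(ρ₁ * (geoCK i c).dist a a')) * (2 * Sb * ((geoCK i c).len a')⁻¹)) :=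
      hasMajorant_mono (g := toB6 (geoCK i c) Rr H) _ (hasMajorant_mul_of_rowLocal_right (g := toB6 (geoCK i c) Rr H) (blkBK i c)
        (fun a => 2 * ((geoCK i c).len a)⁻¹ * Sb) hcF (hlocB ν) E0) fun a a' => le_of_eq (by ring)
    have hS : HasMajorant (g := toB6 (geoCK i c) Rr H) (blkBK i c) (conj b ((shiftOpB' (𝔸 := 𝔸) i ν).restrictScalars ℝ))
        (fun a a' => Real.exp ((1 - 9 / 5000) * ρ₁) * Real.exp (-((1 - 9 / 5000) * ρ₁ * (geoCK i c).dist a a'))) :=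
      hasMajorant_conj_shiftOpB' i c b Rr H hκρ' ν
    have hout := hasMajorant_weighted_mul_shift i c Rr H (blkBK i c) dB (δ := ρ₁) (α := 9 / 5000) (α' := 9 / 5000) (r := 2 * Sb) (A := A₁) (Λ := Λ4)
      (by positivity) hA₁ hΛ4 hκρ' (by norm_num) htri hPΛ3 h261' hin hS
    refine hasMajorant_mono (g := toB6 (geoCK i c) Rr H) _ hout fun a a' => ?_
    have hexp1 : Real.exp ((1 - 9 / 5000) * ρ₁) ≤ Real.exp ρ₁ := Real.exp_le_exp.2 (by nlinarith)
    have hrest : 0 ≤ A₁ * (2 * Sb) * Λ4 * c1 ^ 2 * (geoCK i c).len a * Real.exp (-(δf * (geoCK i c).dist a a')) :=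
      mul_nonneg (mul_nonneg (mul_nonneg (mul_nonneg (mul_nonneg hA₁ (mul_nonneg (by norm_num) hSb)) hΛ4) (sq_nonneg _)) (hlen0 a)) (Real.exp_nonneg _)
    calc A₁ * (2 * Sb) * Λ4 * Real.exp ((1 - 9 / 5000) * ρ₁) * B6.c1 dB ((1 - 9 / 5000) * ρ₁) (9 / 5000) ^ 2 * (geoCK i c).len a *
          Real.exp (-((1 - 9 / 5000) * ((1 - 9 / 5000) * ρ₁) * (geoCK i c).dist a a'))
        = Real.exp ((1 - 9 / 5000) * ρ₁) * (A₁ * (2 * Sb) * Λ4 * c1 ^ 2 * (geoCK i c).len a * Real.exp (-(δf * (geoCK i c).dist a a'))) := by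
          rw [hc1def, hδfdef]; ring
      _ ≤ Real.exp ρ₁ * (A₁ * (2 * Sb) * Λ4 * c1 ^ 2 * (geoCK i c).len a * Real.exp (-(δf * (geoCK i c).dist a a'))) :=
          mul_le_mul_of_nonneg_right hexp1 hrest
      _ = K₁ * (geoCK i c).len a * Real.exp (-(δf * (geoCK i c).dist a a')) := by rw [hK₁def]; ring
  -- COLLECT
  have hin : 0 ≤ 2 * Sb * A₁ + 2 * K₁ + 4 * Sb ^ 2 * A₁ := by
    have h1 := mul_nonneg hSb hA₁; have h2 := mul_nonneg (sq_nonneg Sb) hA₁; linarith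
  have hD : 0 ≤ ((d : ℝ) + 1) * (2 * Sb * A₁ + 2 * K₁ + 4 * Sb ^ 2 * A₁) := mul_nonneg (by positivity) hin
  have hle1 : A₁ + K₁ ≤ Bf := by rw [hBfdef]; linarith
  have hleB : K₀ + K₁ ≤ Bf := by rw [hBfdef]; linarith
  have hleK : K₁ ≤ Bf := by rw [hBfdef]; linarith
  have hleA : A₁ ≤ Bf := by rw [hBfdef]; linarith
  refine ⟨hunit, hasMajorant_weaken i c Rr H _ hlen2 hleA hBf' hδfρ₁ E0, fun ν => hasMajorant_weaken i c Rr H _ hlen0 hle1 hBf' le_rfl (hEntry1 ν),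
    fun ν => hasMajorant_weaken i c Rr H _ hlen0 hleB hBf' le_rfl (hEntry1s ν), hEntry3, fun ν B₂ ρ' hB₂ hρ' hρ'δ hR => ?_⟩
  have e : G * conj b (cdsBₗ i V ν) = G * conj b (cdsBₗ i (fun _ _ => (1 : 𝔸ˣ)) ν) +
      G * conj b (mulDefBB i V ν) * conj b ((shiftOpB' (𝔸 := 𝔸) i ν).restrictScalars ℝ) := by
    rw [cdsBₗ_eq_add, conj_add', B9Eq352DivFormLetters.conj_mul, mul_add, mul_assoc]
  rw [e]
  refine hasMajorant_mono (g := toB6 (geoCK i c) Rr H) _ (hasMajorant_add (g := toB6 (geoCK i c) Rr H) _ hR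
    (hasMajorant_weaken i c Rr H _ hlen0 hleK hBf' hρ'δ (hT2 ν))) fun a a' => le_of_eq (by ring)

/-- ★★★ **COROLLARY 3.6 AT ONE COVER CUBE — THE (3.42) ENTRIES OF THE BOND-SECTOR CUBE LETTER `G_□(Ṽ_□) = Δ_{a,□}(Ṽ_□)⁻¹` WITH THE COVARIANT DERIVATIVES AT `Ṽ_□`,
OVER THE CUBE SEQUENCE's BLOCKS**, uniformly in the member and the cube: there are `δ > 0`, `B_f ≥ 0`, thresholds `M₀, T₀, N₀` and `a₁ > 0` (functions of `d, L, b₀, b₁`,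
the basis datum `M₂, Σ‖b_j‖`) such that for every member above the thresholds, every cover cube `□` and every (3.35) cube datum `(A; Q, C, ξ, Λ)` of Hermitian type with
`max(C, C(1+D₁θ))Λ² ≤ a₁`, with `Ṽ := locCfgY i □ η A`, `G := conj b(G_□(Ṽ))`: `Δ_{a,□}(Ṽ)` is a unit; `G ≺ B_f(Lⁿη)²e^{−δd}`; `conj b(∇_{Ṽ,ν})·G ≺ B_f·Lⁿη·e^{−δd}`
(all `ν`; the COVARIANT bond derivative (3.3) at `Ṽ`); `conj b(Δ_Ṽ)·G ≺ B_f·1·e^{−δd}` (the COVARIANT bond Laplacian (3.23) at `Ṽ`); and the right entry MODULO its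
flat half: for every `ν`, `B₂ ≥ 0`, `0 ≤ ρ′ ≤ δ`, `G·conj b(∇*_{1,ν}) ≺ B₂·Lⁿη·e^{−ρ′d}` ⟹ `G·conj b(∇*_{Ṽ,ν}) ≺ (B₂ + B_f)·Lⁿη·e^{−ρ′d}` — print's (3.42) for `G(U)` of
Theorem 3.3 at the localised field (Cor. 3.6: «Theorems 3.1-3.3 hold for the operators G′(U), (Q′(U)G′²(U)Q′\*(U))⁻¹, G(U) constructed for the sequence {Ω′_j}»), in
[4]'s block-majorant form; the (3.42)₃ flat half is cell GAPS G-B9-02 (p33 RIGHT-ENTRY-L0 + r06 `gExt_rightEntry_of_386L`), displayed.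
[cite: Balaban1985BackgroundPropagators, Cor. 3.6 p.408 l.1–10, Thm 3.3 p.399, Thm 3.1 (3.42) p.397, Thm 3.4 p.400, p.403 l.1–9, (3.70) p.404, (3.100) p.413, p.409 l.1–5; Balaban1984PropagatorsII, (2.51)–(2.55) p.232, Lemma 2.1 (2.60)–(2.63) p.234, Prop. 2.6 (2.136) p.247] -/
theorem cor36_G_cube_entries_at_locCfg (hℓ : 1 ≤ ℓ) (hb₀ : 0 < b₀) (hb₁ : b₀ ≤ b₁) (M₂ : ℝ) (hM₂ : 0 ≤ M₂)
    (hrepr : ∀ (v : 𝔸) (j : ι), |b.repr v j| ≤ M₂ * ‖v‖) :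
    ∃ δ Bf M₀ T₀ : ℝ, ∃ N₀ : ℕ, 0 < δ ∧ 0 ≤ Bf ∧ ∃ a₁ : ℝ, 0 < a₁ ∧
    ∀ (i : KIdx d ℓ hd hL b₀ b₁) (c : ↥(cubes (toKT i).D.toDomains)) (Rr : ℝ) (H : Prop),
      M₀ ≤ ((ℓ : ℝ) + 1) * (toKT i).Mh → N₀ + 1 ≤ (toKT i).R * ((ℓ + 1) * (toKT i).Mh) → T₀ ≤ RM1 i →
    ∀ (A : AfldY 𝔸 i) (Q : Set (Site (PV d ℓ i.m i.K hd hL) 0)) (C ξ Λ : ℝ),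
      0 ≤ C → 0 < ξ → 1 ≤ Λ → ξ ≤ 5 * (SC i c : ℝ) * (kGeo i).eta → LatticeNorms.scaleLen ((ℓ : ℝ) + 1) (kGeo i).eta (c.1.1 + 1) ≤ Λ * ξ →
      (∀ x : Site (PV d ℓ i.m i.K hd hL) 0, NearC i c (35 * SC i c / 8 + 1) (boxEquiv i.hN x).1 → x ∈ Q) →
      (∀ κ, ∀ x ∈ Q, ‖A κ x‖ ≤ C * ξ⁻¹) →
      (∀ μ ν, ∀ x ∈ Q, ‖(((kGeo i).eta : ℂ)⁻¹) • covD (shiftsV1 (PV d ℓ i.m i.K hd hL)) (fun _ _ => (1 : 𝔸ˣ)) μ (A ν) x‖ ≤ C * (ξ ^ 2)⁻¹) →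
      (∀ (t : ℝ) (κ : Fin (d + 1)) (x : Site (PV d ℓ i.m i.K hd hL) 0), ‖NormedSpace.exp ((I * (t : ℂ)) • A κ x)‖ ≤ 1) →
      sRead C Λ ≤ a₁ →
      IsUnit (deltaACubeY i c (parSymY i) (parBY i) (locCfgY i c (kGeo i).eta A)) ∧
      HasMajorant (g := toB6 (geoCK i c) Rr H) (blkBK i c) (GVK b i c (parSymY i) (parBY i) (locCfgY i c (kGeo i).eta A))
        (fun a a' => Bf * (geoCK i c).len a ^ 2 * Real.exp (-(δ * (geoCK i c).dist a a'))) ∧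
      (∀ ν : Fin (d + 1), HasMajorant (g := toB6 (geoCK i c) Rr H) (blkBK i c)
        (conj b (cdBₗ i (locCfgY i c (kGeo i).eta A) ν) * GVK b i c (parSymY i) (parBY i) (locCfgY i c (kGeo i).eta A))
        (fun a a' => Bf * (geoCK i c).len a * Real.exp (-(δ * (geoCK i c).dist a a')))) ∧
      HasMajorant (g := toB6 (geoCK i c) Rr H) (blkBK i c)
        (conj b (lapBₗ i (locCfgY i c (kGeo i).eta A)) * GVK b i c (parSymY i) (parBY i) (locCfgY i c (kGeo i).eta A))
        (fun a a' => Bf * 1 * Real.exp (-(δ * (geoCK i c).dist a a'))) ∧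
      (∀ (ν : Fin (d + 1)) (B₂ ρ' : ℝ), 0 ≤ B₂ → 0 ≤ ρ' → ρ' ≤ δ →
        HasMajorant (g := toB6 (geoCK i c) Rr H) (blkBK i c)
          (GVK b i c (parSymY i) (parBY i) (locCfgY i c (kGeo i).eta A) * conj b (cdsBₗ i (fun _ _ => (1 : 𝔸ˣ)) ν))
          (fun a a' => B₂ * (geoCK i c).len a * Real.exp (-(ρ' * (geoCK i c).dist a a'))) →
        HasMajorant (g := toB6 (geoCK i c) Rr H) (blkBK i c)
          (GVK b i c (parSymY i) (parBY i) (locCfgY i c (kGeo i).eta A) * conj b (cdsBₗ i (locCfgY i c (kGeo i).eta A) ν))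
          (fun a a' => (B₂ + Bf) * (geoCK i c).len a * Real.exp (-(ρ' * (geoCK i c).dist a a')))) := by
  obtain ⟨δ, Bf, M₀, T₀, N₀, hδ, hBf, a₁, ha₁, h⟩ := cor36_G_cube_entries_at_locCfg' b hℓ hb₀ hb₁ M₂ hM₂ hrepr
  refine ⟨δ, Bf, M₀, T₀, N₀, hδ, hBf, a₁, ha₁, fun i c Rr H hM hN hT A Q C ξ Λ hC hξ hΛ hξS hΛξ hQ hA hdA hAu hsa => ?_⟩
  obtain ⟨h0, h1, h2, -, h4, h5⟩ := h i c Rr H hM hN hT A Q C ξ Λ hC hξ hΛ hξS hΛξ hQ hA hdA hAu hsa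
  exact ⟨h0, h1, h2, h4, h5⟩

end Main

end Literature.MathematicalPhysics.QuantumFieldTheory.Balaban1983to89.B9Cor36GCubeEntriesAtV

end
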